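import Literature.MathematicalPhysics.QuantumFieldTheory.Balaban1983to89.T4HistoryLipschitzSegment

/-!
# T4HistoryLipschitzLinearSize — Bałaban's linear size `d_k(X)` in the kernel (lattice-edge form): (2.27) proved with
its constant `5 = ν + 1`, (2.30) upper half proved / lower half corrected and scoped, (2.32) repaired (and refuted as a
general statement about cube families), and NE9 ∧ fading memory on a torus chart from decay IN THE LINEAR SIZE

Scope (honest framing).  Finite-volume, one-scale lattice geometry of big cubes and an end-to-end corollary of the v1.4
theorem `T4HistoryLipschitzSegment.cubeChart_ne9_and_fadingMemory_of_domainDecay` on the finite torus `Fin ν → ZMod N`.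
Nothing here is an infinite-volume, continuum, mass-gap or Clay-problem statement, and no step of the manuscripts under
audit is used as a hypothesis: every `theorem` below is kernel-proved from the definitions; the printed formulas are quoted
only to TYPE the statements (docstring tags `[cite: …]` locate the printed shape, `[folklore]` marks elementary lemmas).

What is formalised.  [I] p.257 defines the linear size of a cube family `X` of one scale: «Consider a class of tree graphs
contained in X and intersecting all the cubes in X. A length of a shortest graph in this class, divided by M, is the
linear size of X, and is denoted by d_j(X)», and adds «there are also the shortest tree graphs formed by edges of cubes in
X, hence an equivalent definition can be formulated, based on such graphs only.»  We formalise the SECOND formulation over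
any coordinate group `G` (sites `Fin ν → G`; `G = ZMod N` is the torus of `T4HistoryLipschitzCubeGeometry` §6, `G = ℤ` the
infinite lattice used for the counterexample of §6): a cube is its lower corner `m`, its corners are `m + Σ_{i∈ε} e_i`
(`cornerVec`, `IsCorner`), its edges join corners differing in one direction (`EdgeAdj X`), two cubes have a common wall iff
`m' = m ± e_i` (`WallAdj`, = `torusAdj ν N` on the torus by `rfl`); a LATTICE SKELETON of `X` is a nonempty set of lattice
points connected through edges of cubes of `X` and containing a corner of every cube of `X` (`IsSkeleton`), and
`linSize X = min (#S − 1)` over skeletons (`0` if none).  (The two printed formulations are not literally equal — a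
`3×3×1×1` block of cubes has a Steiner tree of length `1 + √3 < 3 =` its lattice value — and the continuum one is the
smaller; all statements below concern the lattice-edge `d`.)

Results (all kernel-checked, no `sorry`).
* §2–§3, [II] (2.30) p.18 «(3·2³)⁻¹M⁻⁴|Y| ≤ d_k(Y) ≤ M⁻⁴|Y| − 1»: the UPPER half for every wall-connected family
  (`linSize_le_card_sub_one`: the lower corners are a skeleton — also the `d_le` field of a `CubeChart`); the LOWER half in
  the corrected form `#X ≤ 2^ν (d(X) + 1)` (`card_le_two_pow_mul_linSize_succ`: a lattice point is a corner of `≤ 2^ν`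
  cubes), which gives the printed `(3·2³)⁻¹·#X ≤ d(X)` on T⁴ as soon as `#X ≥ 48` (`printedLower_of_card_ge`) — e.g. for
  the domains `Y(σ) = □̃⁴∪(∪_{Δ∈σ}Δ)` of (1.9)–(1.10) p.4 (`□̃⁴` is a cube of size `9M`: [I] p.257 «we define □̃ⁿ as a
  cube of the size (1 + 2n)M and with a center at the center of □», i.e. `9⁴` big cubes) — while the printed form fails
  for a one-cube family (`not_printedLower_singleton`: `d = 0`; the class `𝐃_k` of [I] p.257 contains the one-cube
  domains).  RANGE REMARK (XREAD finding F1 of the reader seat b2b-balaban-pv12-g19, GAPS C-pv12g19-1 — its kernel version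
  is that seat's sibling leaf, NOT this file, and nothing here depends on it): counting the new cubes along a spanning
  tree of a skeleton (a lattice point `c ± e_i` is a corner of at most `2^{ν−1}` cubes not already cornered at `c`) gives
  the sharp `#X ≤ 2^ν + 2^{ν−1}·d(X)`, so the printed constant `3·2³` — also (1.28) p.8 «M⁻⁴|Y| ≤ 3·2³d_k(Y)» — is EXACT
  on T⁴ for every family of linear size `≥ 1` (`16 + 8d ≤ 24d`), and the printed lower half fails EXACTLY for the
  families of linear size `0` (at most `2^ν` cubes with a common corner), which print excludes from its sums: [II] p.8
  «because we sum over X with d_j(X) ≠ 0, as it follows from our inductive construction»; the weaker count proved here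
  suffices for every use in this file.  Finally, the conversion of decay in `d` into decay in the number of cubes
  (`exp_neg_mul_linSize_le`).
* §4, [II] (2.27) p.18 «Σ_{Y∈𝐃}(d_k(Y) + 5) ≥ d_k(Y₀) + 5», «Because ∪_{Y∈𝐃} Y = Y₀ and Y₀ is a connected domain, hence the
  definition of d_k(Y) implies the inequality»: PROVED for every nonempty finite family of nonempty families with skeletons
  whose union is wall-connected, with the constant `ν + 1` (`= 5` on T⁴) (`linSize_biUnion_add_le_sum`), from the merge
  lemma `exists_isSkeleton_union` (two skeletons and a shared or wall-adjacent cube merge at the cost of a corner path,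
  `≤ ν` new points, and one cube edge).
* §4, [II] (2.32) p.18 «Σ_i d_k(Y_i) + 4M⁻⁴|Z₀∖Y₀| ≥ d_k(Z₀)» («By a simple geometric argument»), REPAIRED and PROVED as
  `d(Z₀) + (ν+1) ≤ Σ_i (d(Y_i) + (ν+1)) + (ν+1)·#(Z₀∖∪Y_i)` (`linSize_add_le_sum_add_mul_card_sdiff`) for a wall-connected
  `Z₀` and any nonempty sub-families `Y_i` with skeletons.  In the use of (2.32) for (2.33) p.19 the extra `(ν+1) = 5` per
  component is paid by the factors `ε₂` that (2.33) discards («We have used the assumption ε₂ ≤ 1»; p.18 assumes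
  `ε₂e^{5κ} ≤ 1`), and `4 ↦ 5` per cube by reading «(1/20)γ₂ε₁²/γ² ≥ 4κ» (p.18) with `5κ`.
* §5–§6: the printed (2.32) is NOT a general fact about wall-connected cube families: for the plus-shaped `Z₀ ⊆ ℤ⁴` of
  nine cubes and `Y₀ = Z₀ ∖ {centre}` with its four two-cube components, the printed right side is `0 + 4·1 = 4` but
  `d(Z₀) ≥ 6` (`six_le_linSize_plusZ`, `not_printedIneq232`), by the EXTENT LEMMA `sum_abs_sub_le_card_sub_one` (a connected
  set spans, in integer coordinates of total edge-variation `≤ 1`, at most `#S − 1`).  Print's components `Y_i` are unions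
  of localization domains (fat cores `□̃⁴` with cubes attached, p.4) and `Z₀∖Y₀` the cubes of a polymer; the hub deficit of
  the example is local and is not removed by attaching fat cores at the far ends of the arms (remark, not certified here).
* §7: decay of coefficient tables in the linear size, `‖c_ω(Y)‖ ≤ α₄(k)e^{−a·d(dom Y)}` (TYPE: the summand
  «+ Σ_{Y∈𝐃} α₄exp(−δκd_k(Y))» of [II] (2.20) p.16 — contour radius (2.18) × table size (1.36) — `a = δκ`), gives the
  per-domain decay in the number of cubes consumed by the v1.4 end-to-end theorem (`domainDecay_of_linSizeDecay`), whence
  `torus_ne9_and_fadingMemory_of_linSizeDecay`: NE9 ∧ fading memory (`T4OutputRate.NE9`, `FadingMemory`) on a torus cube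
  chart with the (L‴) hypothesis replaced by decay in `d`.

References: [Balaban1987RG1] T. Bałaban, Renormalization group approach to lattice gauge field theories. I, Comm. Math.
Phys. 109 (1987) 249–301, p.257 (linear size; connected families «two consecutive cubes have a common wall»; (0.26));
[Balaban1988RG2Cluster] part II, Comm. Math. Phys. 116 (1988) 1–22: (1.9)–(1.10) p.4 (localization domains
`Y(σ) = □̃⁴ ∪ ∪_{Δ∈σ}Δ` and wall-connectedness), (2.18)–(2.20) p.16, the «Y₀ = ∪Y_i», «𝐃 = ∪𝐃_i» sentences p.17, (2.27),
(2.28), (2.30), (2.31), (2.32) p.18, (2.33) p.19; [FriedliVelenik2017] S. Friedli, Y. Velenik, Statistical Mechanics of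
Lattice Systems (CUP 2017), Lemma 3.38 (lattice animals; in the tree as `Polymer.sum_isConn_pow_card_le`, used through the
v1.4 theorem).

v1.0.1 (DOCFIX, docstring-only; every declaration byte-identical to v1 p192684): the TYPE label of the decay-in-`d`
hypothesis now quotes the printed displays verbatim (the (2.20) summand, the (2.18) radius, [I] (0.25)) instead of a
composite formula (citation-police finding P-t4lit1g6-1); the [I] p.257 phrases in `IsSkeleton` are quoted as two separate
spans (INFO I-1); the scope remarks on (2.30) distinguish the class `𝐃_k` (contains one-cube domains) from the domains
`Y(σ) ⊇ □̃⁴` (`□̃⁴` = a `9M`-cube, [I] p.257).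
v1.0.2 (DOCFIX, docstring-only; every declaration byte-identical to v1): folds the XREAD verdict of b2b-balaban-pv12-g19
(GAPS C-pv12g19-1): F2 — a stale declaration name in the docstring of `linSize_add_le_sum_add_mul_card_sdiff`
(`not_printedIneq232`); F1 — the RANGE REMARK on the printed lower half of (2.30) (exact for `d ≥ 1` by the sharp count
`#X ≤ 2^ν + 2^{ν−1}d`, failing exactly at `d = 0`, which [II] p.8 excludes), replacing the vaguer «fails for small
families» wording of v1/v1.0.1; no statement, proof or import changed.
-/

noncomputable section

namespace Literature.MathematicalPhysics.QuantumFieldTheory.Balaban1983to89.T4HistoryLipschitzLinearSize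

open scoped BigOperators
open Metric Set MeasureTheory
open Literature.Probability.LatticeModels
open Literature.MathematicalPhysics.QuantumFieldTheory.Balaban1983to89.T4OutputRate
open Literature.MathematicalPhysics.QuantumFieldTheory.Balaban1983to89.T4ActivityLipschitz
open Literature.MathematicalPhysics.QuantumFieldTheory.Balaban1983to89.T4HistoryLipschitzRecursion
open Literature.MathematicalPhysics.QuantumFieldTheory.Balaban1983to89.T4HistoryLipschitzOuter
open Literature.MathematicalPhysics.QuantumFieldTheory.Balaban1983to89.T4HistoryLipschitzActivity
open Literature.MathematicalPhysics.QuantumFieldTheory.Balaban1983to89.T4HistoryLipschitzEntropy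
open Literature.MathematicalPhysics.QuantumFieldTheory.Balaban1983to89.T4HistoryLipschitzCubeGeometry
open Literature.MathematicalPhysics.QuantumFieldTheory.Balaban1983to89.T4HistoryLipschitzActivity (ClusterGeom)
open Literature.MathematicalPhysics.QuantumFieldTheory.Balaban1983to89.T4HistoryLipschitzSegment

/-! ## §1 Big cubes of one scale as lattice cubes: corners, cube edges, the wall adjacency -/

section Lattice

variable {ν : ℕ} {G : Type*} [AddCommGroup G] [One G] [DecidableEq G]

/-- The corner offset `Σ_{i ∈ ε} e_i` of a unit lattice cube: the corner of the cube with lower corner `m` indexed by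
the coordinate subset `ε` is `m + cornerVec ε`. [cite: Balaban1987RG1, p.257] -/
def cornerVec (ε : Finset (Fin ν)) : Fin ν → G := fun i => if i ∈ ε then 1 else 0

omit [DecidableEq G] in
/-- the lower corner: `cornerVec ∅ = 0`. [folklore] -/
@[simp] theorem cornerVec_empty : (cornerVec (∅ : Finset (Fin ν)) : Fin ν → G) = 0 := by
  funext i; simp [cornerVec]

omit [DecidableEq G] in
/-- adding a coordinate direction to `ε` moves the corner by the unit vector `e_i`. [folklore] -/
theorem cornerVec_insert {ε : Finset (Fin ν)} {i : Fin ν} (hi : i ∉ ε) :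
    (cornerVec (insert i ε) : Fin ν → G) = cornerVec ε + Pi.single i 1 := by
  funext j
  by_cases hj : j = i
  · subst hj; simp [cornerVec, hi]
  · simp [cornerVec, hj]

omit [DecidableEq G] in
/-- `cornerVec {i} = e_i`. [folklore] -/
theorem cornerVec_singleton (i : Fin ν) : (cornerVec ({i} : Finset (Fin ν)) : Fin ν → G) = Pi.single i 1 := by
  rw [← Finset.insert_empty, cornerVec_insert (Finset.notMem_empty _), cornerVec_empty, zero_add]

omit [DecidableEq G] in
/-- removing a direction `i ∈ ε`: `cornerVec ε = cornerVec (ε.erase i) + e_i`. [folklore] -/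
theorem cornerVec_eq_erase_add {ε : Finset (Fin ν)} {i : Fin ν} (hi : i ∈ ε) :
    (cornerVec ε : Fin ν → G) = cornerVec (ε.erase i) + Pi.single i 1 := by
  rw [← cornerVec_insert (Finset.notMem_erase i ε), Finset.insert_erase hi]

/-- `c` is a CORNER of the big cube with lower corner `m`: `c = m + Σ_{i∈ε} e_i` for a coordinate subset `ε`.
[cite: Balaban1987RG1, p.257] -/
def IsCorner (m c : Fin ν → G) : Prop := ∃ ε : Finset (Fin ν), c = m + cornerVec ε

omit [DecidableEq G] in
/-- the lower corner is a corner. [folklore] -/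
theorem isCorner_self (m : Fin ν → G) : IsCorner m m := ⟨∅, by simp⟩

omit [DecidableEq G] in
/-- `m + cornerVec ε` is a corner of `m`. [folklore] -/
theorem isCorner_add_cornerVec (m : Fin ν → G) (ε : Finset (Fin ν)) : IsCorner m (m + cornerVec ε) := ⟨ε, rfl⟩

/-- **CUBE-EDGE ADJACENCY** of lattice points relative to a cube family `X`: `c, c'` are the two endpoints of an EDGE
of a cube of `X` ([I] p.257 «tree graphs formed by edges of cubes in X»): for some `m ∈ X`, `ε` and `i ∉ ε`,
`{c, c'} = {m + cornerVec ε, m + cornerVec (insert i ε)}`. [cite: Balaban1987RG1, p.257] -/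
def EdgeAdj (X : Finset (Fin ν → G)) (c c' : Fin ν → G) : Prop :=
  ∃ m ∈ X, ∃ ε : Finset (Fin ν), ∃ i : Fin ν, i ∉ ε ∧
    ((c = m + cornerVec ε ∧ c' = m + cornerVec (insert i ε)) ∨ (c' = m + cornerVec ε ∧ c = m + cornerVec (insert i ε)))

/-- the cube-edge adjacency is symmetric. [folklore] -/
instance instSymmEdgeAdj (X : Finset (Fin ν → G)) : Std.Symm (EdgeAdj X) :=
  ⟨fun _ _ ⟨m, hm, ε, i, hi, h⟩ => ⟨m, hm, ε, i, hi, h.symm⟩⟩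

omit [DecidableEq G] in
/-- the cube-edge adjacency is monotone in the cube family. [folklore] -/
theorem edgeAdj_mono {X X' : Finset (Fin ν → G)} (h : X ⊆ X') {c c' : Fin ν → G} (hc : EdgeAdj X c c') :
    EdgeAdj X' c c' := by
  obtain ⟨m, hm, ε, i, hi, h'⟩ := hc
  exact ⟨m, h hm, ε, i, hi, h'⟩

omit [DecidableEq G] in
/-- the two endpoints of a cube edge differ by a unit vector: `c' = c ± e_i`. [folklore] -/
theorem exists_single_of_edgeAdj {X : Finset (Fin ν → G)} {c c' : Fin ν → G} (h : EdgeAdj X c c') :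
    ∃ i : Fin ν, c' = c + Pi.single i 1 ∨ c = c' + Pi.single i 1 := by
  obtain ⟨m, -, ε, i, hi, h'⟩ := h
  refine ⟨i, ?_⟩
  rcases h' with ⟨hc, hc'⟩ | ⟨hc', hc⟩
  · exact Or.inl (by rw [hc', hc, cornerVec_insert hi, add_assoc])
  · exact Or.inr (by rw [hc, hc', cornerVec_insert hi, add_assoc])

/-- **WALL ADJACENCY** of big cubes (lower corners) over a coordinate group `G`: `y = x ± e_i`; for `G = ZMod N` this
is literally `torusAdj ν N` of `T4HistoryLipschitzCubeGeometry` §6 (`wallAdj_eq_torusAdj`). [cite: Balaban1987RG1, p.257] -/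
def WallAdj (x y : Fin ν → G) : Prop := ∃ i : Fin ν, y = x + Pi.single i 1 ∨ y = x - Pi.single i 1

/-- the wall adjacency is symmetric. [folklore] -/
instance instSymmWallAdj : Std.Symm (WallAdj : (Fin ν → G) → (Fin ν → G) → Prop) :=
  ⟨fun x y ⟨i, h⟩ => ⟨i, by
    rcases h with h | h
    · exact Or.inr (by rw [h, add_sub_cancel_right])
    · exact Or.inl (by rw [h, sub_add_cancel])⟩⟩

/-- the wall adjacency is decidable. [folklore] -/
instance instDecidableRelWallAdj : DecidableRel (WallAdj : (Fin ν → G) → (Fin ν → G) → Prop) := fun x y => by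
  unfold WallAdj; infer_instance

/-- On the discrete torus the wall adjacency is `torusAdj`. [folklore] -/
theorem wallAdj_eq_torusAdj (ν N : ℕ) : (WallAdj : (Fin ν → ZMod N) → (Fin ν → ZMod N) → Prop) = torusAdj ν N := rfl

omit [DecidableEq G] in
/-- **two wall-adjacent cubes of `X` have lower corners joined by a cube edge of `X`**: for `y = x + e_i` the edge
`[x, x + e_i]` of the cube `x`, for `y = x − e_i` the edge `[y, y + e_i]` of the cube `y`. [folklore] -/
theorem edgeAdj_of_wallAdj {X : Finset (Fin ν → G)} {x y : Fin ν → G} (hx : x ∈ X) (hy : y ∈ X) (h : WallAdj x y) :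
    EdgeAdj X x y := by
  obtain ⟨i, h⟩ := h
  rcases h with h | h
  · refine ⟨x, hx, ∅, i, Finset.notMem_empty _, Or.inl ⟨by simp, ?_⟩⟩
    rw [Finset.insert_empty, cornerVec_singleton, h]
  · refine ⟨y, hy, ∅, i, Finset.notMem_empty _, Or.inr ⟨by simp, ?_⟩⟩
    rw [Finset.insert_empty, cornerVec_singleton, h, sub_add_cancel]

end Lattice

/-! ## §2 Lattice skeletons and the linear size -/

section Skeleton

variable {ν : ℕ} {G : Type*} [AddCommGroup G] [One G] [DecidableEq G]

/-- `S` is a LATTICE SKELETON of the cube family `X`: a nonempty finite set of lattice points, CONNECTED through edges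
of cubes of `X` (rooted reachability `Polymer.IsConn` for `EdgeAdj X`), containing a corner of EVERY cube of `X` — the
vertex set of one of the «tree graphs formed by edges of cubes in X» that is «intersecting all the cubes in X» ([I] p.257,
two phrases; a lattice-edge graph meets a closed unit cube iff one of its vertices is a corner of it).  A spanning tree of such a
graph has `#S − 1` edges, each of length `M` (one big-cube side). [cite: Balaban1987RG1, p.257] -/
def IsSkeleton (X S : Finset (Fin ν → G)) : Prop :=
  (∃ a ∈ S, Polymer.IsConn (EdgeAdj X) S a) ∧ ∀ m ∈ X, ∃ c ∈ S, IsCorner m c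

/-- **THE LINEAR SIZE `d(X)` (lattice-edge form)**: the least number of cube edges of a connected cube-edge graph
inside `X` meeting every cube of `X` = `min {#S − 1 : S a lattice skeleton of X}` (`0` if `X` has no skeleton, e.g.
`X` not connected).  [I] p.257: «Consider a class of tree graphs contained in X and intersecting all the cubes in X.
A length of a shortest graph in this class, divided by M, is the linear size of X, and is denoted by d_j(X) … there
are also the shortest tree graphs formed by edges of cubes in X, hence an equivalent definition can be formulated,
based on such graphs only.»  This file formalises the second (lattice-edge) formulation. [cite: Balaban1987RG1, p.257] -/
def linSize (X : Finset (Fin ν → G)) : ℕ := sInf {n | ∃ S, IsSkeleton X S ∧ S.card = n + 1}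

omit [DecidableEq G] in
/-- a skeleton bounds the linear size: `d(X) ≤ #S − 1`. [folklore] -/
theorem linSize_le_card_sub_one_of_isSkeleton {X S : Finset (Fin ν → G)} (h : IsSkeleton X S) :
    linSize X ≤ S.card - 1 := by
  have hpos : 0 < S.card := Finset.card_pos.2 (let ⟨a, ha, _⟩ := h.1; ⟨a, ha⟩)
  exact Nat.sInf_le ⟨S, h, by omega⟩

omit [DecidableEq G] in
/-- the linear size is attained: if `X` has a skeleton, it has one with `#S = d(X) + 1`. [folklore] -/
theorem exists_isSkeleton_card_eq {X : Finset (Fin ν → G)} (h : ∃ S, IsSkeleton X S) :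
    ∃ S, IsSkeleton X S ∧ S.card = linSize X + 1 := by
  obtain ⟨S, hS⟩ := h
  have hpos : 0 < S.card := Finset.card_pos.2 (let ⟨a, ha, _⟩ := hS.1; ⟨a, ha⟩)
  exact Nat.sInf_mem (s := {n | ∃ S, IsSkeleton X S ∧ S.card = n + 1}) ⟨S.card - 1, S, hS, by omega⟩

omit [DecidableEq G] in
/-- lower bounds transfer: if every skeleton has `≥ n + 1` points (and some skeleton exists), `n ≤ d(X)`. [folklore] -/
theorem le_linSize {X : Finset (Fin ν → G)} {n : ℕ} (hex : ∃ S, IsSkeleton X S)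
    (h : ∀ S, IsSkeleton X S → n + 1 ≤ S.card) : n ≤ linSize X := by
  obtain ⟨S, hS, hcard⟩ := exists_isSkeleton_card_eq hex
  have := h S hS
  omega

omit [DecidableEq G] in
/-- **`d(X) = 0` when all cubes of `X` have a common corner** (a single cube; two cubes with a common wall; the
`2^ν` cubes around a lattice point): the one-point skeleton. [folklore] -/
theorem linSize_eq_zero_of_common_corner {X : Finset (Fin ν → G)} {c : Fin ν → G} (h : ∀ m ∈ X, IsCorner m c) :
    linSize X = 0 := by
  have hS : IsSkeleton X {c} :=
    ⟨⟨c, Finset.mem_singleton_self _, Polymer.isConn_singleton c⟩, fun m hm => ⟨c, Finset.mem_singleton_self _, h m hm⟩⟩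
  have := linSize_le_card_sub_one_of_isSkeleton hS
  simpa using this

omit [DecidableEq G] in
/-- a single big cube has linear size `0`. [folklore] -/
theorem linSize_singleton (m : Fin ν → G) : linSize ({m} : Finset (Fin ν → G)) = 0 :=
  linSize_eq_zero_of_common_corner (c := m) fun m' hm' => by rw [Finset.mem_singleton.1 hm']; exact isCorner_self m

/-- reachability is monotone in the adjacency relation (on a fixed vertex set). [folklore] -/
theorem reach_mono_rel {α : Type*} {adj adj' : α → α → Prop} {Q : Finset α}
    (h : ∀ x ∈ Q, ∀ y ∈ Q, adj x y → adj' x y) {a b : α} (hab : Polymer.Reach adj Q a b) : Polymer.Reach adj' Q a b :=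
  Relation.ReflTransGen.mono (fun x y (hxy : Polymer.AdjIn adj Q x y) =>
    (⟨hxy.1, hxy.2.1, h x hxy.1 y hxy.2.1 hxy.2.2⟩ : Polymer.AdjIn adj' Q x y)) _ _ hab

/-- connectedness is monotone in the adjacency relation. [folklore] -/
theorem isConn_mono_rel {α : Type*} {adj adj' : α → α → Prop} {Q : Finset α}
    (h : ∀ x ∈ Q, ∀ y ∈ Q, adj x y → adj' x y) {a : α} (ha : Polymer.IsConn adj Q a) : Polymer.IsConn adj' Q a :=
  ⟨ha.1, fun b hb => reach_mono_rel h (ha.2 b hb)⟩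

omit [DecidableEq G] in
/-- **A WALL-CONNECTED cube family is its own skeleton** (lower corners; consecutive cubes of a wall chain have lower
corners joined by a cube edge of the family): the TYPE of [I] p.257 «A connected family means that for every pair □, □′
of cubes from the family there exists a sequence □, □₁, …, □ₙ, □′ of cubes belonging to the family and such that two
consecutive cubes have a common wall». [cite: Balaban1987RG1, p.257] -/
theorem isSkeleton_self_of_isConn {X : Finset (Fin ν → G)} {a : Fin ν → G} (h : Polymer.IsConn WallAdj X a) :
    IsSkeleton X X :=
  ⟨⟨a, h.1, isConn_mono_rel (fun _ hx _ hy hxy => edgeAdj_of_wallAdj hx hy hxy) h⟩,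
    fun m hm => ⟨m, hm, isCorner_self m⟩⟩

omit [DecidableEq G] in
/-- **(2.30), UPPER HALF (kernel): `d_k(Y) ≤ M⁻⁴|Y| − 1`** for a wall-connected cube family — the lower corners form a
skeleton.  [II] (2.30) p.18 «d_k(Y) ≤ M⁻⁴|Y| − 1 holding for localization domains Y∈𝐃_k» (`M⁻⁴|Y|` = the number of big
cubes of `Y`). [cite: Balaban1988RG2Cluster, (2.30) p.18; Balaban1987RG1, p.257] -/
theorem linSize_le_card_sub_one {X : Finset (Fin ν → G)} {a : Fin ν → G} (h : Polymer.IsConn WallAdj X a) :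
    linSize X ≤ X.card - 1 :=
  linSize_le_card_sub_one_of_isSkeleton (isSkeleton_self_of_isConn h)

/-- **EVERY LATTICE POINT IS A CORNER OF AT MOST `2^ν` CUBES, hence `#X ≤ 2^ν · #S` for a set `S` meeting every cube
of `X` at a corner** (`m = c − cornerVec ε`). [folklore] -/
theorem card_le_two_pow_mul_card {X S : Finset (Fin ν → G)} (h : ∀ m ∈ X, ∃ c ∈ S, IsCorner m c) :
    X.card ≤ 2 ^ ν * S.card := by
  classical
  let f : (Fin ν → G) × Finset (Fin ν) → (Fin ν → G) := fun p => p.1 - cornerVec p.2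
  have hsub : X ⊆ (S ×ˢ (Finset.univ : Finset (Finset (Fin ν)))).image f := by
    intro m hm
    obtain ⟨c, hc, ε, hcε⟩ := h m hm
    exact Finset.mem_image.2 ⟨(c, ε), Finset.mem_product.2 ⟨hc, Finset.mem_univ _⟩, by simp [f, hcε]⟩
  calc X.card ≤ ((S ×ˢ (Finset.univ : Finset (Finset (Fin ν)))).image f).card := Finset.card_le_card hsub
    _ ≤ (S ×ˢ (Finset.univ : Finset (Finset (Fin ν)))).card := Finset.card_image_le
    _ = 2 ^ ν * S.card := by rw [Finset.card_product, Finset.card_univ, Fintype.card_finset, Fintype.card_fin, mul_comm]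

/-- **(2.30), LOWER HALF CORRECTED (kernel): `#X ≤ 2^ν · (d(X) + 1)`** for a cube family with a skeleton (e.g. a
wall-connected one) — on T⁴: `M⁻⁴|Y| ≤ 16 (d_k(Y) + 1)`.  The PRINTED lower half «(3·2³)⁻¹M⁻⁴|Y| ≤ d_k(Y)» of [II] (2.30)
p.18 (= (1.28) p.8) has no additive constant and fails for families of linear size `0` (`not_printedLower_singleton`)
— and ONLY for those: the sharper count `#X ≤ 2^ν + 2^{ν−1}·d(X)` along a spanning tree of a skeleton (XREAD finding F1,
b2b-balaban-pv12-g19; not derived in this file) makes the printed constant exact on T⁴ for `d ≥ 1`, and print's sums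
exclude `d = 0` ([II] p.8 «because we sum over X with d_j(X) ≠ 0, as it follows from our inductive construction»).  From
the weaker count proved here the printed form follows as soon as `M⁻⁴|Y| ≥ 48` (`printedLower_of_card_ge`), which
covers the domains `Y(σ) ⊇ □̃⁴` of (1.9)–(1.10) p.4 (`□̃⁴` = a cube of size `9M`, [I] p.257).
[cite: Balaban1988RG2Cluster, (2.30) p.18, (1.28) p.8; Balaban1987RG1, p.257] -/
theorem card_le_two_pow_mul_linSize_succ {X : Finset (Fin ν → G)} (h : ∃ S, IsSkeleton X S) :
    X.card ≤ 2 ^ ν * (linSize X + 1) := by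
  obtain ⟨S, hS, hcard⟩ := exists_isSkeleton_card_eq h
  rw [← hcard]
  exact card_le_two_pow_mul_card hS.2

omit [DecidableEq G] in
/-- **THE PRINTED LOWER HALF OF (2.30) FAILS FOR A ONE-CUBE FAMILY**: `(3·2³)⁻¹ · 1 ≤ d = 0` is false — [II] (2.30) p.18
«(3·2³)⁻¹M⁻⁴|Y| ≤ d_k(Y)» is stated «for localization domains Y∈𝐃_k», a class that contains the one-cube domains
([I] p.257 «Such a domain is a union of a connected, finite family of cubes from π_j»); the failure is confined to the
families of linear size `0` (sharp count `#X ≤ 2^ν + 2^{ν−1}·d`, XREAD finding F1 of b2b-balaban-pv12-g19 — for `d ≥ 1`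
the printed constant is exact), which print excludes from its sums ([II] p.8 «because we sum over X with d_j(X) ≠ 0, as
it follows from our inductive construction»); in particular it holds for the domains `Y(σ) ⊇ □̃⁴` that enter
(2.20)/(2.33) (`printedLower_of_card_ge`). [cite: Balaban1988RG2Cluster, (2.30) p.18, p.8; Balaban1987RG1, p.257] -/
theorem not_printedLower_singleton (m : Fin ν → G) :
    ¬ ((3 * 2 ^ 3 : ℝ)⁻¹ * ((({m} : Finset (Fin ν → G)).card : ℕ) : ℝ) ≤ (linSize ({m} : Finset (Fin ν → G)) : ℝ)) := by
  rw [linSize_singleton, Finset.card_singleton]; norm_num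

/-- **THE PRINTED LOWER HALF OF (2.30) ON T⁴ FOR FAMILIES OF AT LEAST `48` BIG CUBES (kernel)**: `(3·2³)⁻¹·#X ≤ d(X)`
from `#X ≤ 16 (d(X) + 1)` and `#X ≥ 48` — in particular for every domain of [II] (1.9)–(1.10) p.4 «The set
Y(σ) = □̃⁴∪(∪_{Δ∈σ}Δ)», since `□̃⁴` is a cube of size `(1 + 2·4)M = 9M` ([I] p.257 «we define □̃ⁿ as a cube of the size
(1 + 2n)M and with a center at the center of □»), i.e. `9⁴ = 6561 ≥ 48` big cubes.  (The threshold `48` is an artefact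
of the weaker count `#X ≤ 2^ν(d+1)`; with the sharp count of the header's range remark the printed inequality holds for
every family with `d ≥ 1` — not derived in this file.)
[cite: Balaban1988RG2Cluster, (2.30) p.18, (1.9)-(1.10) p.4; Balaban1987RG1, p.257] -/
theorem printedLower_of_card_ge {G : Type*} [AddCommGroup G] [One G] [DecidableEq G] {X : Finset (Fin 4 → G)}
    (h : ∃ S, IsSkeleton X S) (h48 : 48 ≤ X.card) :
    (3 * 2 ^ 3 : ℝ)⁻¹ * (X.card : ℝ) ≤ (linSize X : ℝ) := by
  have h1 : (X.card : ℝ) ≤ 2 ^ 4 * ((linSize X : ℝ) + 1) := by exact_mod_cast card_le_two_pow_mul_linSize_succ h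
  have h2 : (48 : ℝ) ≤ X.card := by exact_mod_cast h48
  norm_num at h1 ⊢
  linarith

/-- **DECAY IN THE LINEAR SIZE IS DECAY IN THE NUMBER OF CUBES (kernel)**: `e^{−a·d(X)} ≤ e^{a} · (e^{−a/2^ν})^{#X}` for
`0 ≤ a` and `X` with a skeleton — the conversion used (with the printed lower half of (2.30)) after (2.29) p.18; here
from the corrected lower half. [cite: Balaban1988RG2Cluster, (2.30) p.18] -/
theorem exp_neg_mul_linSize_le {X : Finset (Fin ν → G)} {a : ℝ} (ha : 0 ≤ a) (h : ∃ S, IsSkeleton X S) :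
    Real.exp (-(a * (linSize X : ℝ))) ≤ Real.exp a * Real.exp (-(a / 2 ^ ν)) ^ X.card := by
  have h1 : (X.card : ℝ) ≤ 2 ^ ν * ((linSize X : ℝ) + 1) := by exact_mod_cast card_le_two_pow_mul_linSize_succ h
  have h2 : (X.card : ℝ) * (a / 2 ^ ν) ≤ 2 ^ ν * ((linSize X : ℝ) + 1) * (a / 2 ^ ν) :=
    mul_le_mul_of_nonneg_right h1 (div_nonneg ha (pow_nonneg zero_le_two _))
  have h3 : (2 : ℝ) ^ ν * ((linSize X : ℝ) + 1) * (a / 2 ^ ν) = a * ((linSize X : ℝ) + 1) := by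
    field_simp
  rw [← Real.exp_nat_mul, ← Real.exp_add]
  exact Real.exp_le_exp.2 (by nlinarith)

end Skeleton

/-! ## §4 Merging skeletons through a common or wall-adjacent cube: (2.27) with Bałaban's constant `5 = ν + 1` -/

section Merge

variable {ν : ℕ} {G : Type*} [AddCommGroup G] [One G] [DecidableEq G]

/-- adding a vertex adjacent to the root keeps a set connected (new root = the added vertex). [folklore] -/
theorem isConn_insert_of_adj {α : Type*} [DecidableEq α] {adj : α → α → Prop} {P : Finset α} {c c₁ : α}
    (h : Polymer.IsConn adj P c₁) (hadj : adj c c₁) : Polymer.IsConn adj (insert c P) c := by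
  refine ⟨Finset.mem_insert_self _ _, fun b hb => ?_⟩
  rcases Finset.mem_insert.1 hb with rfl | hb
  · exact Polymer.Reach.refl _
  · exact (Polymer.Reach.single (Finset.mem_insert_self _ _) (Finset.mem_insert_of_mem h.1) hadj).trans
      ((h.2 b hb).mono (Finset.subset_insert _ _))

/-- the union of two connected sets with a common root is connected. [folklore] -/
theorem isConn_union {α : Type*} [DecidableEq α] {adj : α → α → Prop} {A B : Finset α} {c : α}
    (hA : Polymer.IsConn adj A c) (hB : Polymer.IsConn adj B c) : Polymer.IsConn adj (A ∪ B) c := by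
  refine ⟨Finset.mem_union_left _ hA.1, fun b hb => ?_⟩
  rcases Finset.mem_union.1 hb with hb | hb
  · exact (hA.2 b hb).mono Finset.subset_union_left
  · exact (hB.2 b hb).mono Finset.subset_union_right

/-- the union of two connected sets, the root of the second lying in or adjacent to the first, is connected. [folklore] -/
theorem isConn_union_of_touch {α : Type*} [DecidableEq α] {adj : α → α → Prop} {A B : Finset α} {c b : α}
    (hA : Polymer.IsConn adj A c) (hB : Polymer.IsConn adj B b) (hb : b ∈ A ∨ ∃ u ∈ A, adj u b) :
    Polymer.IsConn adj (A ∪ B) c := by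
  refine ⟨Finset.mem_union_left _ hA.1, fun x hx => ?_⟩
  rcases Finset.mem_union.1 hx with hx | hx
  · exact (hA.2 x hx).mono Finset.subset_union_left
  · have hcb : Polymer.Reach adj (A ∪ B) c b := by
      rcases hb with hb | ⟨u, hu, hub⟩
      · exact (hA.2 b hb).mono Finset.subset_union_left
      · exact ((hA.2 u hu).mono Finset.subset_union_left).tail (Finset.mem_union_left _ hu)
          (Finset.mem_union_right _ hB.1) hub
    exact hcb.trans ((hB.2 x hx).mono Finset.subset_union_right)

omit [DecidableEq G] in
/-- two disjoint coordinate subsets have at most `ν` elements together. [folklore] -/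
theorem card_sdiff_add_card_sdiff_le (ε ε' : Finset (Fin ν)) : (ε \ ε').card + (ε' \ ε).card ≤ ν := by
  rw [← Finset.card_union_of_disjoint disjoint_sdiff_sdiff]
  exact (Finset.card_le_univ _).trans (by simp)

/-- **CORNER PATHS INSIDE ONE CUBE**: two corners `m + cornerVec ε`, `m + cornerVec ε'` of a cube `m ∈ X` are joined
by a chain of cube edges of `m` through at most `#(ε ∆ ε') + 1 ≤ ν + 1` corners (flip one coordinate at a time).
[folklore] -/
theorem exists_cornerPath {X : Finset (Fin ν → G)} {m : Fin ν → G} (hm : m ∈ X) (ε ε' : Finset (Fin ν)) :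
    ∃ P : Finset (Fin ν → G), m + cornerVec ε ∈ P ∧ m + cornerVec ε' ∈ P ∧
      Polymer.IsConn (EdgeAdj X) P (m + cornerVec ε) ∧ P.card ≤ (ε \ ε').card + (ε' \ ε).card + 1 := by
  classical
  suffices H : ∀ n, ∀ ε : Finset (Fin ν), (ε \ ε').card + (ε' \ ε).card = n →
      ∃ P : Finset (Fin ν → G), m + cornerVec ε ∈ P ∧ m + cornerVec ε' ∈ P ∧
        Polymer.IsConn (EdgeAdj X) P (m + cornerVec ε) ∧ P.card ≤ (ε \ ε').card + (ε' \ ε).card + 1 from H _ ε rfl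
  intro n
  induction n with
  | zero =>
    intro ε h
    have h1 : ε \ ε' = ∅ := Finset.card_eq_zero.1 (by omega)
    have h2 : ε' \ ε = ∅ := Finset.card_eq_zero.1 (by omega)
    have : ε = ε' := subset_antisymm (Finset.sdiff_eq_empty_iff_subset.1 h1) (Finset.sdiff_eq_empty_iff_subset.1 h2)
    subst this
    exact ⟨{m + cornerVec ε}, Finset.mem_singleton_self _, Finset.mem_singleton_self _, Polymer.isConn_singleton _,
      by simp⟩
  | succ n ih =>
    intro ε h
    by_cases h1 : (ε \ ε').Nonempty
    · obtain ⟨i, hi⟩ := h1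
      obtain ⟨hiε, hiε'⟩ := Finset.mem_sdiff.1 hi
      have e1 : ε.erase i \ ε' = (ε \ ε').erase i := by
        ext j; by_cases hj : j = i <;> simp [hj, Finset.mem_sdiff, Finset.mem_erase, hiε']
      have e2 : ε' \ ε.erase i = ε' \ ε := by
        ext j; by_cases hj : j = i <;> simp [hj, Finset.mem_sdiff, Finset.mem_erase, hiε']
      have hn : (ε.erase i \ ε').card + (ε' \ ε.erase i).card = n := by
        rw [e1, e2, Finset.card_erase_of_mem hi]; have := Finset.card_pos.2 ⟨i, hi⟩; omega
      obtain ⟨P₁, h₁, h₁', hconn, hcard⟩ := ih (ε.erase i) hn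
      have hadj : EdgeAdj X (m + cornerVec ε) (m + cornerVec (ε.erase i)) :=
        ⟨m, hm, ε.erase i, i, Finset.notMem_erase i ε, Or.inr ⟨rfl, by rw [Finset.insert_erase hiε]⟩⟩
      refine ⟨insert (m + cornerVec ε) P₁, Finset.mem_insert_self _ _, Finset.mem_insert_of_mem h₁',
        isConn_insert_of_adj hconn hadj, (Finset.card_insert_le _ _).trans ?_⟩
      rw [hn] at hcard; omega
    · have h2 : (ε' \ ε).Nonempty := by
        rw [Finset.not_nonempty_iff_eq_empty] at h1
        rw [h1, Finset.card_empty, zero_add] at h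
        exact Finset.card_pos.1 (by omega)
      obtain ⟨i, hi⟩ := h2
      obtain ⟨hiε', hiε⟩ := Finset.mem_sdiff.1 hi
      have e1 : insert i ε \ ε' = ε \ ε' := by
        ext j; by_cases hj : j = i <;> simp [hj, Finset.mem_sdiff, hiε', hiε]
      have e2 : ε' \ insert i ε = (ε' \ ε).erase i := by
        ext j; by_cases hj : j = i <;> simp [hj, Finset.mem_sdiff, Finset.mem_erase, hiε']
      have hn : (insert i ε \ ε').card + (ε' \ insert i ε).card = n := by
        rw [e1, e2, Finset.card_erase_of_mem hi]; have := Finset.card_pos.2 ⟨i, hi⟩; omega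
      obtain ⟨P₁, h₁, h₁', hconn, hcard⟩ := ih (insert i ε) hn
      have hadj : EdgeAdj X (m + cornerVec ε) (m + cornerVec (insert i ε)) :=
        ⟨m, hm, ε, i, hiε, Or.inl ⟨rfl, rfl⟩⟩
      refine ⟨insert (m + cornerVec ε) P₁, Finset.mem_insert_self _ _, Finset.mem_insert_of_mem h₁',
        isConn_insert_of_adj hconn hadj, (Finset.card_insert_le _ _).trans ?_⟩
      rw [hn] at hcard; omega

omit [DecidableEq G] in
/-- **PORT LEMMA**: if the cube `m₁` equals or is wall-adjacent to a cube `m₂ ∈ X₂`, every corner `c₂` of `m₂` equals a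
corner of `m₁` or is joined to one by an edge of the cube `m₂`. [folklore] -/
theorem exists_corner_touch {X₂ : Finset (Fin ν → G)} {m₁ m₂ c₂ : Fin ν → G} (hm₂ : m₂ ∈ X₂)
    (h : m₁ = m₂ ∨ WallAdj m₁ m₂) (hc₂ : IsCorner m₂ c₂) :
    ∃ ε : Finset (Fin ν), m₁ + cornerVec ε = c₂ ∨ EdgeAdj X₂ (m₁ + cornerVec ε) c₂ := by
  obtain ⟨ε₂, hc₂⟩ := hc₂
  rcases h with rfl | ⟨i, h⟩
  · exact ⟨ε₂, Or.inl hc₂.symm⟩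
  rcases h with h | h
  · by_cases hi : i ∈ ε₂
    · refine ⟨ε₂, Or.inr ⟨m₂, hm₂, ε₂.erase i, i, Finset.notMem_erase i ε₂, Or.inl ⟨?_, ?_⟩⟩⟩
      · rw [cornerVec_eq_erase_add hi, h]; abel
      · rw [Finset.insert_erase hi, hc₂]
    · refine ⟨insert i ε₂, Or.inl ?_⟩
      rw [cornerVec_insert hi, hc₂, h]; abel
  · have h' : m₁ = m₂ + Pi.single i 1 := by rw [h, sub_add_cancel]
    by_cases hi : i ∈ ε₂
    · refine ⟨ε₂.erase i, Or.inl ?_⟩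
      rw [hc₂, cornerVec_eq_erase_add hi, h']; abel
    · refine ⟨ε₂, Or.inr ⟨m₂, hm₂, ε₂, i, hi, Or.inr ⟨hc₂, ?_⟩⟩⟩
      rw [cornerVec_insert hi, h']; abel

/-- **MERGING TWO SKELETONS (kernel)**: skeletons `S₁` of `X₁` and `S₂` of `X₂`, with a cube of `X₁` equal or
wall-adjacent to a cube of `X₂`, merge into a skeleton of `X₁ ∪ X₂` with at most `#S₁ + #S₂ + ν` points (a corner
path inside the cube of `X₁`, `≤ ν` new points, plus at most one edge of the cube of `X₂`) — i.e. at most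
`d₁ + d₂ + (ν + 1)` edges: the source of the constant `5 = ν + 1` of [II] (2.27) p.18 on T⁴. [cite: Balaban1988RG2Cluster, (2.27) p.18; Balaban1987RG1, p.257] -/
theorem exists_isSkeleton_union {X₁ X₂ S₁ S₂ : Finset (Fin ν → G)} (h₁ : IsSkeleton X₁ S₁) (h₂ : IsSkeleton X₂ S₂)
    (hinc : ∃ m₁ ∈ X₁, ∃ m₂ ∈ X₂, m₁ = m₂ ∨ WallAdj m₁ m₂) :
    ∃ S, IsSkeleton (X₁ ∪ X₂) S ∧ S.card ≤ S₁.card + S₂.card + ν := by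
  classical
  obtain ⟨m₁, hm₁, m₂, hm₂, hmm⟩ := hinc
  obtain ⟨⟨a₁, _, hS₁⟩, hcor₁⟩ := h₁
  obtain ⟨⟨a₂, _, hS₂⟩, hcor₂⟩ := h₂
  obtain ⟨c₁, hc₁S, ε₁, hc₁⟩ := hcor₁ m₁ hm₁
  obtain ⟨c₂, hc₂S, hc₂⟩ := hcor₂ m₂ hm₂
  obtain ⟨ε', hport⟩ := exists_corner_touch hm₂ hmm hc₂
  obtain ⟨P, hP₁, hP', hPconn, hPcard⟩ := exists_cornerPath (X := X₁) hm₁ ε₁ ε'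
  rw [← hc₁] at hP₁ hPconn
  have hmono₁ : ∀ x ∈ S₁ ∪ P, ∀ y ∈ S₁ ∪ P, EdgeAdj X₁ x y → EdgeAdj (X₁ ∪ X₂) x y :=
    fun _ _ _ _ h => edgeAdj_mono Finset.subset_union_left h
  have hA : Polymer.IsConn (EdgeAdj (X₁ ∪ X₂)) (S₁ ∪ P) c₁ :=
    isConn_mono_rel hmono₁ (isConn_union (isConn_reroot hS₁ hc₁S) hPconn)
  have hB : Polymer.IsConn (EdgeAdj (X₁ ∪ X₂)) S₂ c₂ :=
    isConn_mono_rel (fun _ _ _ _ h => edgeAdj_mono Finset.subset_union_right h) (isConn_reroot hS₂ hc₂S)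
  have htouch : c₂ ∈ S₁ ∪ P ∨ ∃ u ∈ S₁ ∪ P, EdgeAdj (X₁ ∪ X₂) u c₂ := by
    rcases hport with h | h
    · exact Or.inl (Finset.mem_union_right _ (h ▸ hP'))
    · exact Or.inr ⟨_, Finset.mem_union_right _ hP', edgeAdj_mono Finset.subset_union_right h⟩
  refine ⟨S₁ ∪ P ∪ S₂, ⟨⟨c₁, Finset.mem_union_left _ (Finset.mem_union_left _ hc₁S), isConn_union_of_touch hA hB htouch⟩,
    fun m hm => ?_⟩, ?_⟩
  · rcases Finset.mem_union.1 hm with hm | hm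
    · obtain ⟨c, hc, hcc⟩ := hcor₁ m hm
      exact ⟨c, Finset.mem_union_left _ (Finset.mem_union_left _ hc), hcc⟩
    · obtain ⟨c, hc, hcc⟩ := hcor₂ m hm
      exact ⟨c, Finset.mem_union_right _ hc, hcc⟩
  · have hsub : S₁ ∪ P ∪ S₂ ⊆ S₁ ∪ P.erase c₁ ∪ S₂ := by
      intro x hx
      rcases Finset.mem_union.1 hx with hx | hx
      · rcases Finset.mem_union.1 hx with hx | hx
        · exact Finset.mem_union_left _ (Finset.mem_union_left _ hx)
        · by_cases hxc : x = c₁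
          · exact Finset.mem_union_left _ (Finset.mem_union_left _ (hxc ▸ hc₁S))
          · exact Finset.mem_union_left _ (Finset.mem_union_right _ (Finset.mem_erase.2 ⟨hxc, hx⟩))
      · exact Finset.mem_union_right _ hx
    have hν := card_sdiff_add_card_sdiff_le ε₁ ε'
    have hPe : (P.erase c₁).card = P.card - 1 := Finset.card_erase_of_mem hP₁
    have hPpos : 0 < P.card := Finset.card_pos.2 ⟨c₁, hP₁⟩
    calc (S₁ ∪ P ∪ S₂).card ≤ (S₁ ∪ P.erase c₁ ∪ S₂).card := Finset.card_le_card hsub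
      _ ≤ (S₁ ∪ P.erase c₁).card + S₂.card := Finset.card_union_le _ _
      _ ≤ S₁.card + (P.erase c₁).card + S₂.card := by gcongr; exact Finset.card_union_le _ _
      _ ≤ S₁.card + S₂.card + ν := by rw [hPe]; omega

/-- **(2.27) FOR TWO DOMAINS (kernel): `d(X₁ ∪ X₂) ≤ d(X₁) + d(X₂) + (ν + 1)`**, i.e. `d(X₁ ∪ X₂) + 5 ≤ (d(X₁) + 5) +
(d(X₂) + 5)` on T⁴, for cube families with skeletons sharing a cube or a wall. [cite: Balaban1988RG2Cluster, (2.27) p.18] -/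
theorem linSize_union_le {X₁ X₂ : Finset (Fin ν → G)} (h₁ : ∃ S, IsSkeleton X₁ S) (h₂ : ∃ S, IsSkeleton X₂ S)
    (hinc : ∃ m₁ ∈ X₁, ∃ m₂ ∈ X₂, m₁ = m₂ ∨ WallAdj m₁ m₂) :
    linSize (X₁ ∪ X₂) ≤ linSize X₁ + linSize X₂ + (ν + 1) := by
  obtain ⟨S₁, hS₁, hc₁⟩ := exists_isSkeleton_card_eq h₁
  obtain ⟨S₂, hS₂, hc₂⟩ := exists_isSkeleton_card_eq h₂
  obtain ⟨S, hS, hcard⟩ := exists_isSkeleton_union hS₁ hS₂ hinc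
  have := linSize_le_card_sub_one_of_isSkeleton hS
  omega

omit [DecidableEq G] in
/-- a one-cube family is its own skeleton. [folklore] -/
theorem isSkeleton_singleton (m : Fin ν → G) : IsSkeleton ({m} : Finset (Fin ν → G)) {m} :=
  ⟨⟨m, Finset.mem_singleton_self _, Polymer.isConn_singleton m⟩,
    fun m' hm' => ⟨m, Finset.mem_singleton_self _, by rw [Finset.mem_singleton.1 hm']; exact isCorner_self m⟩⟩

/-- **(2.27) (kernel): `Σ_{Y∈D} (d(Y) + (ν+1)) ≥ d(Y₀) + (ν+1)` for a nonempty finite family `D` of nonempty cube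
families with skeletons (e.g. wall-connected ones) whose union `Y₀` is wall-connected** — [II] (2.27) p.18 «Because
∪_{Y∈𝐃} Y = Y₀ and Y₀ is a connected domain, hence the definition of d_k(Y) implies the inequality Σ_{Y∈𝐃}(d_k(Y) + 5)
≥ d_k(Y₀) + 5», with `5 = ν + 1` on T⁴.  Proof: grow a sub-family one incident domain at a time (`exists_isSkeleton_union`);
connectedness of `Y₀` supplies the next incident domain. [cite: Balaban1988RG2Cluster, (2.27) p.18; Balaban1987RG1, p.257] -/
theorem linSize_biUnion_add_le_sum {D : Finset (Finset (Fin ν → G))} (hne : D.Nonempty)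
    (hsk : ∀ Y ∈ D, ∃ S, IsSkeleton Y S) (hY : ∀ Y ∈ D, Y.Nonempty) {a : Fin ν → G}
    (hconn : Polymer.IsConn WallAdj (D.biUnion id) a) :
    linSize (D.biUnion id) + (ν + 1) ≤ ∑ Y ∈ D, (linSize Y + (ν + 1)) := by
  classical
  -- growth: sub-families of every size with a skeleton of their union within budget
  have grow : ∀ k, 1 ≤ k → k ≤ D.card → ∃ E ⊆ D, E.card = k ∧
      ∃ S, IsSkeleton (E.biUnion id) S ∧ S.card + ν ≤ ∑ Y ∈ E, (linSize Y + (ν + 1)) := by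
    intro k hk
    induction k with
    | zero => exact absurd hk (by omega)
    | succ k ih =>
      intro hkD
      rcases Nat.eq_zero_or_pos k with rfl | hkpos
      · obtain ⟨Y₀, hY₀⟩ := hne
        obtain ⟨S, hS, hc⟩ := exists_isSkeleton_card_eq (hsk Y₀ hY₀)
        refine ⟨{Y₀}, Finset.singleton_subset_iff.2 hY₀, by simp, S, by simpa using hS, ?_⟩
        simp only [Finset.sum_singleton]; omega
      obtain ⟨E, hED, hEcard, S, hS, hSc⟩ := ih hkpos (by omega)
      -- a domain of D outside E sharing a cube or a wall with the union of E
      have hEne : E.Nonempty := Finset.card_pos.1 (by omega)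
      obtain ⟨Y', hY'D, hY'E⟩ : ∃ Y' ∈ D, Y' ∉ E := by
        by_contra hcon
        push Not at hcon
        have := Finset.card_le_card hcon
        omega
      obtain ⟨Y, hYD, hYE, hinc⟩ : ∃ Y ∈ D, Y ∉ E ∧
          ∃ m₁ ∈ E.biUnion id, ∃ m₂ ∈ Y, m₁ = m₂ ∨ WallAdj m₁ m₂ := by
        by_cases hcov : D.biUnion id ⊆ E.biUnion id
        · obtain ⟨m, hm⟩ := hY Y' hY'D
          exact ⟨Y', hY'D, hY'E, m, hcov (Finset.mem_biUnion.2 ⟨Y', hY'D, hm⟩), m, hm, Or.inl rfl⟩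
        · obtain ⟨v, hv, hvU⟩ := Finset.not_subset.1 hcov
          obtain ⟨Y₁, hY₁⟩ := hEne
          obtain ⟨u₀, hu₀⟩ := hY Y₁ (hED hY₁)
          have hu₀U : u₀ ∈ E.biUnion id := Finset.mem_biUnion.2 ⟨Y₁, hY₁, hu₀⟩
          have hu₀D : u₀ ∈ D.biUnion id := Finset.mem_biUnion.2 ⟨Y₁, hED hY₁, hu₀⟩
          have hreach : Polymer.Reach WallAdj (D.biUnion id) u₀ v := (hconn.2 u₀ hu₀D).symm.trans (hconn.2 v hv)
          have hnot : ¬ ∀ u ∈ E.biUnion id, ∀ w ∈ D.biUnion id, WallAdj u w → w ∈ E.biUnion id :=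
            fun hcl => hvU (hreach.mem_of_closed hu₀U hcl)
          push Not at hnot
          obtain ⟨u, hu, w, hw, huw, hwU⟩ := hnot
          obtain ⟨Y, hYD, hwY⟩ := Finset.mem_biUnion.1 hw
          have hYE : Y ∉ E := fun h => hwU (Finset.mem_biUnion.2 ⟨Y, h, hwY⟩)
          exact ⟨Y, hYD, hYE, u, hu, w, hwY, Or.inr huw⟩
      obtain ⟨SY, hSY, hSYc⟩ := exists_isSkeleton_card_eq (hsk Y hYD)
      obtain ⟨S', hS', hS'c⟩ := exists_isSkeleton_union hS hSY hinc
      refine ⟨insert Y E, Finset.insert_subset hYD hED, by rw [Finset.card_insert_of_notMem hYE, hEcard], S', ?_, ?_⟩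
      · simpa [Finset.biUnion_insert, Finset.union_comm] using hS'
      · rw [Finset.sum_insert hYE]; omega
  have hcard : 1 ≤ D.card := Finset.card_pos.2 hne
  obtain ⟨E, hED, hEcard, S, hS, hSc⟩ := grow D.card hcard le_rfl
  have hE : E = D := Finset.eq_of_subset_of_card_le hED (by omega)
  subst hE
  have h1 := linSize_le_card_sub_one_of_isSkeleton hS
  have h2 : 0 < S.card := Finset.card_pos.2 (let ⟨x, hx, _⟩ := hS.1; ⟨x, hx⟩)
  omega

/-- **(2.32) REPAIRED (kernel): `d(Z₀) + (ν+1) ≤ Σ_i (d(Y_i) + (ν+1)) + (ν+1)·#(Z₀ ∖ ∪Y_i)`** for a wall-connected `Z₀`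
and any finite family of nonempty sub-families `Y_i ⊆ Z₀` with skeletons (e.g. the connected components of a
sub-domain `Y₀ ⊆ Z₀`): (2.27) applied to the family `{Y_i} ∪ {{□} : □ ∈ Z₀ ∖ ∪Y_i}`.  The PRINTED [II] (2.32) p.18
«Σ_i d_k(Y_i) + 4M⁻⁴|Z₀∖Y₀| ≥ d_k(Z₀)» («By a simple geometric argument») has constant `4` and NO term per component;
it fails for a plus-shaped `Z₀` (§6, `not_printedIneq232`).  In the use of (2.32) for (2.33) p.19 the per-component
constant is absorbed by the standing assumption «2E₀ε₁C₁α₄⁻¹α₆⁻¹M^q exp C₂κ₁ exp 5κ ≤ 1» (p.18, = ε₂e^{5κ} ≤ 1) and the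
constant `4 ↦ 5` by «γ² sufficiently small, depending on M and κ» (p.18). [cite: Balaban1988RG2Cluster, (2.32) p.18, (2.33) p.19, (2.27) p.18] -/
theorem linSize_add_le_sum_add_mul_card_sdiff {Z₀ : Finset (Fin ν → G)} {a : Fin ν → G}
    (hZ : Polymer.IsConn WallAdj Z₀ a) {Ys : Finset (Finset (Fin ν → G))} (hsub : ∀ Y ∈ Ys, Y ⊆ Z₀)
    (hsk : ∀ Y ∈ Ys, ∃ S, IsSkeleton Y S) (hY : ∀ Y ∈ Ys, Y.Nonempty) :
    linSize Z₀ + (ν + 1) ≤ ∑ Y ∈ Ys, (linSize Y + (ν + 1)) + (ν + 1) * (Z₀ \ Ys.biUnion id).card := by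
  classical
  set U := Ys.biUnion id with hU
  have hUZ : U ⊆ Z₀ := Finset.biUnion_subset.2 fun Y hY => hsub Y hY
  set D := Ys ∪ (Z₀ \ U).image (fun c => ({c} : Finset (Fin ν → G))) with hD
  have hsingle : ((Z₀ \ U).image (fun c => ({c} : Finset (Fin ν → G)))).biUnion id = Z₀ \ U := by
    rw [Finset.image_biUnion]; exact Finset.biUnion_singleton_eq_self
  have hDU : D.biUnion id = Z₀ := by
    rw [hD, Finset.union_biUnion, hsingle]; exact Finset.union_sdiff_of_subset hUZ
  have hDne : D.Nonempty := by
    rw [Finset.nonempty_iff_ne_empty]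
    rintro hDe
    have : Z₀ = ∅ := by rw [← hDU, hDe, Finset.biUnion_empty]
    exact hZ.nonempty.ne_empty this
  have hsk' : ∀ Y ∈ D, ∃ S, IsSkeleton Y S := by
    intro Y hY
    rcases Finset.mem_union.1 hY with hY | hY
    · exact hsk Y hY
    · obtain ⟨c, -, rfl⟩ := Finset.mem_image.1 hY
      exact ⟨{c}, isSkeleton_singleton c⟩
  have hY' : ∀ Y ∈ D, Y.Nonempty := by
    intro Y hYD
    rcases Finset.mem_union.1 hYD with hYD | hYD
    · exact hY Y hYD
    · obtain ⟨c, -, rfl⟩ := Finset.mem_image.1 hYD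
      exact Finset.singleton_nonempty c
  have hmain := linSize_biUnion_add_le_sum hDne hsk' hY' (a := a) (by rw [hDU]; exact hZ)
  rw [hDU] at hmain
  have hdisj : Disjoint Ys ((Z₀ \ U).image (fun c => ({c} : Finset (Fin ν → G)))) := by
    rw [Finset.disjoint_left]
    intro Y hY hY'
    obtain ⟨c, hc, rfl⟩ := Finset.mem_image.1 hY'
    exact (Finset.mem_sdiff.1 hc).2 (Finset.mem_biUnion.2 ⟨{c}, hY, Finset.mem_singleton_self c⟩)
  have hsum : ∑ Y ∈ D, (linSize Y + (ν + 1)) =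
      ∑ Y ∈ Ys, (linSize Y + (ν + 1)) + (ν + 1) * (Z₀ \ U).card := by
    rw [hD, Finset.sum_union hdisj, Finset.sum_image fun c _ c' _ h => Finset.singleton_injective h]
    simp [linSize_singleton, mul_comm]
  omega

end Merge

/-! ## §5 Lower bounds on the linear size: the multi-coordinate extent lemma -/

section Extent

variable {α : Type*} [DecidableEq α] {adj : α → α → Prop} [Std.Symm adj]

/-- **EXTENT LEMMA (kernel)**: for a family of integer "coordinates" `x j` (`j ∈ s`) whose TOTAL variation along an
edge is `≤ 1` (`Σ_j |x j u − x j v| ≤ 1` for `adj u v`), a connected finite set `S` satisfies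
`Σ_{j∈s} |x j (p j) − x j (q j)| ≤ #S − 1` for ANY points `p j, q j ∈ S` — a spanning tree has `#S − 1` edges and its
`j`-extent is at most the number of its edges moving coordinate `j`.  Proof without trees: remove the root, split the
rest into components, re-root the pairs `(p j, q j)` straddling components at the components' ports, and induct.
[folklore] -/
theorem sum_abs_sub_le_card_sub_one {ι : Type*} (s : Finset ι) (x : ι → α → ℤ)
    (hadj : ∀ u v, adj u v → ∑ j ∈ s, |x j u - x j v| ≤ 1) {S : Finset α} {a : α}
    (hS : Polymer.IsConn adj S a) {p q : ι → α} (hp : ∀ j ∈ s, p j ∈ S) (hq : ∀ j ∈ s, q j ∈ S) :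
    ∑ j ∈ s, |x j (p j) - x j (q j)| ≤ (S.card : ℤ) - 1 := by
  classical
  induction S using Finset.strongInduction generalizing a p q with
  | H S ih =>
  haveI : Nonempty α := ⟨a⟩
  set S' := S.erase a with hS'
  set T := S'.filter (adj a) with hT
  have hTS' : T ⊆ S' := Finset.filter_subset _ _
  have hreach : ∀ b ∈ S', ∃ t ∈ T, Polymer.Reach adj S' t b := by
    intro b hb
    obtain ⟨hba, hbS⟩ := Finset.mem_erase.1 hb
    obtain ⟨t, ht, hat, htb⟩ := (hS.2 b hbS).exists_adj_reach_erase hba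
    exact ⟨t, Finset.mem_filter.2 ⟨ht, hat⟩, htb⟩
  set Cs := Polymer.comps adj S' T with hCs
  have hcardS : (S.card : ℤ) = 1 + ∑ K ∈ Cs, (K.card : ℤ) := by
    have h1 : S'.card + 1 = S.card := Finset.card_erase_add_one hS.1
    have h2 : S'.card = ∑ K ∈ Cs, K.card := Polymer.card_eq_sum_card_comps hTS' hreach
    rw [← h1, h2]; push_cast; ring
  have hroot : ∀ K ∈ Cs, ∃ t ∈ T, Polymer.IsConn adj K t := fun K hK => Polymer.exists_isConn_of_mem_comps hTS' hK
  choose! r hrT hrK using hroot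
  have har : ∀ K ∈ Cs, adj a (r K) := fun K hK => (Finset.mem_filter.1 (hrT K hK)).2
  have hcover : ∀ b ∈ S, b ≠ a → ∃ K ∈ Cs, b ∈ K := by
    intro b hb hba
    have hb' : b ∈ Cs.biUnion id := by
      rw [hCs, Polymer.biUnion_comps_eq hTS' hreach]; exact Finset.mem_erase.2 ⟨hba, hb⟩
    simpa using hb'
  have huniq : ∀ K ∈ Cs, ∀ K' ∈ Cs, ∀ b, b ∈ K → b ∈ K' → K = K' := by
    intro K hK K' hK' b hb hb'
    by_contra hne
    exact Finset.disjoint_left.1 (Polymer.pairwiseDisjoint_comps S' T hK hK' hne) hb hb'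
  have haK : ∀ K ∈ Cs, a ∉ K := fun K hK haK => (Finset.mem_erase.1 (Polymer.subset_of_mem_comps hK haK)).1 rfl
  have hKS : ∀ K ∈ Cs, K ⊂ S := fun K hK =>
    (Polymer.subset_of_mem_comps hK).trans_ssubset (Finset.erase_ssubset hS.1)
  -- re-rooted pairs and the port correction
  let p' : Finset α → ι → α := fun K j => if p j ∈ K then p j else r K
  let q' : Finset α → ι → α := fun K j => if q j ∈ K then q j else r K
  let extra : Finset α → ι → ℤ := fun K j => if (p j ∈ K ↔ q j ∈ K) then 0 else |x j a - x j (r K)|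
  have hextra_nn : ∀ K j, 0 ≤ extra K j := fun K j => by
    dsimp [extra]; split_ifs
    · exact le_rfl
    · exact abs_nonneg _
  have hextra_le : ∀ K j, extra K j ≤ |x j a - x j (r K)| := fun K j => by
    dsimp [extra]; split_ifs
    · exact abs_nonneg _
    · exact le_rfl
  have hkey : ∀ j ∈ s, |x j (p j) - x j (q j)| ≤ ∑ K ∈ Cs, (|x j (p' K j) - x j (q' K j)| + extra K j) := by
    intro j hj
    have hnn : ∀ K ∈ Cs, 0 ≤ |x j (p' K j) - x j (q' K j)| + extra K j :=
      fun K _ => add_nonneg (abs_nonneg _) (hextra_nn K j)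
    by_cases hpa : p j = a <;> by_cases hqa : q j = a
    · rw [hpa, hqa, sub_self, abs_zero]; exact Finset.sum_nonneg hnn
    · obtain ⟨K₁, hK₁, hqK₁⟩ := hcover (q j) (hq j hj) hqa
      have hpK₁ : p j ∉ K₁ := by rw [hpa]; exact haK K₁ hK₁
      refine le_trans ?_ (Finset.single_le_sum hnn hK₁)
      have e1 : p' K₁ j = r K₁ := if_neg hpK₁
      have e2 : q' K₁ j = q j := if_pos hqK₁
      have e3 : extra K₁ j = |x j a - x j (r K₁)| := by dsimp [extra]; rw [if_neg]; tauto
      rw [e1, e2, e3, hpa]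
      calc |x j a - x j (q j)| ≤ |x j a - x j (r K₁)| + |x j (r K₁) - x j (q j)| := abs_sub_le _ _ _
        _ = |x j (r K₁) - x j (q j)| + |x j a - x j (r K₁)| := add_comm _ _
    · obtain ⟨K₀, hK₀, hpK₀⟩ := hcover (p j) (hp j hj) hpa
      have hqK₀ : q j ∉ K₀ := by rw [hqa]; exact haK K₀ hK₀
      refine le_trans ?_ (Finset.single_le_sum hnn hK₀)
      have e1 : p' K₀ j = p j := if_pos hpK₀
      have e2 : q' K₀ j = r K₀ := if_neg hqK₀
      have e3 : extra K₀ j = |x j a - x j (r K₀)| := by dsimp [extra]; rw [if_neg]; tauto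
      rw [e1, e2, e3, hqa]
      calc |x j (p j) - x j a| ≤ |x j (p j) - x j (r K₀)| + |x j (r K₀) - x j a| := abs_sub_le _ _ _
        _ = |x j (p j) - x j (r K₀)| + |x j a - x j (r K₀)| := by rw [abs_sub_comm (x j (r K₀))]
    · obtain ⟨K₀, hK₀, hpK₀⟩ := hcover (p j) (hp j hj) hpa
      obtain ⟨K₁, hK₁, hqK₁⟩ := hcover (q j) (hq j hj) hqa
      by_cases hKK : K₀ = K₁
      · subst hKK
        refine le_trans ?_ (Finset.single_le_sum hnn hK₀)
        have e1 : p' K₀ j = p j := if_pos hpK₀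
        have e2 : q' K₀ j = q j := if_pos hqK₁
        rw [e1, e2]
        exact le_add_of_nonneg_right (hextra_nn K₀ j)
      · have hqK₀ : q j ∉ K₀ := fun h => hKK (huniq K₀ hK₀ K₁ hK₁ (q j) h hqK₁)
        have hpK₁ : p j ∉ K₁ := fun h => hKK (huniq K₀ hK₀ K₁ hK₁ (p j) hpK₀ h)
        have hsub : ({K₀, K₁} : Finset (Finset α)) ⊆ Cs := by
          rw [Finset.insert_subset_iff]; exact ⟨hK₀, Finset.singleton_subset_iff.2 hK₁⟩
        refine le_trans ?_ (Finset.sum_le_sum_of_subset_of_nonneg hsub fun K hK _ => hnn K hK)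
        rw [Finset.sum_pair hKK]
        have e1 : p' K₀ j = p j := if_pos hpK₀
        have e2 : q' K₀ j = r K₀ := if_neg hqK₀
        have e3 : extra K₀ j = |x j a - x j (r K₀)| := by dsimp [extra]; rw [if_neg]; tauto
        have e4 : p' K₁ j = r K₁ := if_neg hpK₁
        have e5 : q' K₁ j = q j := if_pos hqK₁
        have e6 : extra K₁ j = |x j a - x j (r K₁)| := by dsimp [extra]; rw [if_neg]; tauto
        rw [e1, e2, e3, e4, e5, e6]
        have i1 := abs_sub_le (x j (p j)) (x j (r K₀)) (x j (q j))
        have i2 := abs_sub_le (x j (r K₀)) (x j a) (x j (q j))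
        have i3 := abs_sub_le (x j a) (x j (r K₁)) (x j (q j))
        rw [abs_sub_comm (x j (r K₀)) (x j a)] at i2
        linarith
  have hC1 : ∀ K ∈ Cs, ∑ j ∈ s, |x j (p' K j) - x j (q' K j)| ≤ (K.card : ℤ) - 1 := by
    intro K hK
    refine ih K (hKS K hK) (hrK K hK) ?_ ?_
    · intro j _; dsimp [p']; split_ifs with h
      · exact h
      · exact (hrK K hK).1
    · intro j _; dsimp [q']; split_ifs with h
      · exact h
      · exact (hrK K hK).1
  have hC2 : ∀ K ∈ Cs, ∑ j ∈ s, extra K j ≤ 1 := fun K hK =>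
    (Finset.sum_le_sum fun j _ => hextra_le K j).trans (hadj a (r K) (har K hK))
  calc ∑ j ∈ s, |x j (p j) - x j (q j)| ≤ ∑ j ∈ s, ∑ K ∈ Cs, (|x j (p' K j) - x j (q' K j)| + extra K j) :=
        Finset.sum_le_sum hkey
    _ = ∑ K ∈ Cs, (∑ j ∈ s, |x j (p' K j) - x j (q' K j)| + ∑ j ∈ s, extra K j) := by
        rw [Finset.sum_comm]; simp only [Finset.sum_add_distrib]
    _ ≤ ∑ K ∈ Cs, ((K.card : ℤ) - 1 + 1) := Finset.sum_le_sum fun K hK => add_le_add (hC1 K hK) (hC2 K hK)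
    _ = ∑ K ∈ Cs, (K.card : ℤ) := by simp
    _ = (S.card : ℤ) - 1 := by rw [hcardS]; ring

end Extent

/-! ## §6 The printed (2.32) is not a general fact about wall-connected cube families: a plus-shaped `Z₀ ⊆ ℤ⁴` -/

section Counterexample

/-- the unit vector `e_i` of `ℤ⁴`. [folklore] -/
def ue (i : Fin 4) : Fin 4 → ℤ := Pi.single i 1

/-- the PLUS: the cube `0` and the arms `±e₀, ±2e₀, ±e₁, ±2e₁` — nine wall-connected unit cubes of `ℤ⁴`. [folklore] -/
def plusZ : Finset (Fin 4 → ℤ) :=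
  {0, ue 0, ue 0 + ue 0, -ue 0, -ue 0 - ue 0, ue 1, ue 1 + ue 1, -ue 1, -ue 1 - ue 1}

/-- the four ARMS of the plus (two cubes each): the connected components of `plusZ ∖ {0}`. [folklore] -/
def armsZ : Finset (Finset (Fin 4 → ℤ)) :=
  {{ue 0, ue 0 + ue 0}, {-ue 0, -ue 0 - ue 0}, {ue 1, ue 1 + ue 1}, {-ue 1, -ue 1 - ue 1}}

/-- two wall-adjacent cubes form a connected pair. [folklore] -/
theorem isConn_pair {ν : ℕ} {G : Type*} [AddCommGroup G] [One G] [DecidableEq G] {u v : Fin ν → G} (h : WallAdj u v) :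
    Polymer.IsConn WallAdj ({u, v} : Finset (Fin ν → G)) u := by
  refine ⟨Finset.mem_insert_self _ _, fun b hb => ?_⟩
  rcases Finset.mem_insert.1 hb with rfl | hb
  · exact Polymer.Reach.refl _
  · rw [Finset.mem_singleton.1 hb]
    exact Polymer.Reach.single (Finset.mem_insert_self _ _) (Finset.mem_insert_of_mem (Finset.mem_singleton_self _)) h

/-- the plus is wall-connected (rooted at the centre). [folklore] -/
theorem isConn_plusZ : Polymer.IsConn WallAdj plusZ 0 := by
  have m0 : (0 : Fin 4 → ℤ) ∈ plusZ := by simp [plusZ]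
  have w1 : ∀ i : Fin 4, WallAdj (0 : Fin 4 → ℤ) (ue i) := fun i => ⟨i, Or.inl (by simp [ue])⟩
  have w2 : ∀ i : Fin 4, WallAdj (ue i) (ue i + ue i) := fun i => ⟨i, Or.inl rfl⟩
  have w3 : ∀ i : Fin 4, WallAdj (0 : Fin 4 → ℤ) (-ue i) := fun i => ⟨i, Or.inr (by simp [ue])⟩
  have w4 : ∀ i : Fin 4, WallAdj (-ue i) (-ue i - ue i) := fun i => ⟨i, Or.inr rfl⟩
  refine ⟨m0, fun b hb => ?_⟩
  simp only [plusZ, Finset.mem_insert, Finset.mem_singleton] at hb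
  have r1 : ∀ i : Fin 4, ue i ∈ plusZ → Polymer.Reach WallAdj plusZ 0 (ue i) := fun i hi => Polymer.Reach.single m0 hi (w1 i)
  have r3 : ∀ i : Fin 4, -ue i ∈ plusZ → Polymer.Reach WallAdj plusZ 0 (-ue i) := fun i hi => Polymer.Reach.single m0 hi (w3 i)
  rcases hb with rfl | rfl | rfl | rfl | rfl | rfl | rfl | rfl | rfl
  · exact Polymer.Reach.refl _
  · exact r1 0 (by simp [plusZ])
  · exact (r1 0 (by simp [plusZ])).tail (by simp [plusZ]) (by simp [plusZ]) (w2 0)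
  · exact r3 0 (by simp [plusZ])
  · exact (r3 0 (by simp [plusZ])).tail (by simp [plusZ]) (by simp [plusZ]) (w4 0)
  · exact r1 1 (by simp [plusZ])
  · exact (r1 1 (by simp [plusZ])).tail (by simp [plusZ]) (by simp [plusZ]) (w2 1)
  · exact r3 1 (by simp [plusZ])
  · exact (r3 1 (by simp [plusZ])).tail (by simp [plusZ]) (by simp [plusZ]) (w4 1)

/-- points at `ℓ¹`-distance `≥ 2` in the first two coordinates are distinct and not wall-adjacent. [folklore] -/
theorem ne_and_not_wallAdj_of_two_le {y y' : Fin 4 → ℤ} (h : 2 ≤ |y 0 - y' 0| + |y 1 - y' 1|) :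
    y ≠ y' ∧ ¬ WallAdj y y' := by
  constructor
  · rintro rfl; simp at h
  · rintro ⟨i, h' | h'⟩ <;> rw [h'] at h <;> fin_cases i <;> simp at h

/-- **THE LINEAR SIZE OF THE PLUS IS AT LEAST `6`**: a skeleton contains corners of the four tips `±2e₀, ±2e₁`, whose
`0`-th (resp. `1`-st) coordinates differ by `≥ 3`; by the extent lemma `#S − 1 ≥ 3 + 3`. [folklore] -/
theorem six_le_linSize_plusZ : 6 ≤ linSize plusZ := by
  classical
  refine le_linSize ⟨plusZ, isSkeleton_self_of_isConn isConn_plusZ⟩ fun S hS => ?_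
  obtain ⟨⟨a, haS, hconn⟩, hcor⟩ := hS
  obtain ⟨cp0, hcp0, εp0, hp0⟩ := hcor (ue 0 + ue 0) (by simp [plusZ])
  obtain ⟨cm0, hcm0, εm0, hm0⟩ := hcor (-ue 0 - ue 0) (by simp [plusZ])
  obtain ⟨cp1, hcp1, εp1, hp1⟩ := hcor (ue 1 + ue 1) (by simp [plusZ])
  obtain ⟨cm1, hcm1, εm1, hm1⟩ := hcor (-ue 1 - ue 1) (by simp [plusZ])
  let x : Fin 2 → (Fin 4 → ℤ) → ℤ := ![fun u => u 0, fun u => u 1]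
  have hadj : ∀ u v, EdgeAdj plusZ u v → ∑ j ∈ (Finset.univ : Finset (Fin 2)), |x j u - x j v| ≤ 1 := by
    intro u v huv
    obtain ⟨i, h | h⟩ := exists_single_of_edgeAdj huv <;> rw [h, Fin.sum_univ_two] <;>
      fin_cases i <;> simp [x]
  have hext := sum_abs_sub_le_card_sub_one Finset.univ x hadj hconn (p := ![cp0, cp1]) (q := ![cm0, cm1])
    (fun j _ => by fin_cases j <;> simp [hcp0, hcp1]) (fun j _ => by fin_cases j <;> simp [hcm0, hcm1])
  rw [Fin.sum_univ_two] at hext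
  simp only [x, Matrix.cons_val_zero, Matrix.cons_val_one] at hext
  have h0 : 3 ≤ |cp0 0 - cm0 0| := by
    rw [hp0, hm0]; simp only [Pi.add_apply, Pi.sub_apply, Pi.neg_apply, ue, cornerVec, Pi.single_eq_same]
    split_ifs <;> norm_num
  have h1 : 3 ≤ |cp1 1 - cm1 1| := by
    rw [hp1, hm1]; simp only [Pi.add_apply, Pi.sub_apply, Pi.neg_apply, ue, cornerVec, Pi.single_eq_same]
    split_ifs <;> norm_num
  have : (7 : ℤ) ≤ S.card := by linarith
  exact_mod_cast this

/-- **THE PRINTED (2.32) AS A STATEMENT ABOUT CUBE FAMILIES**: for a wall-connected `Z₀`, a family `{Y_i}` of pairwise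
separated (disjoint, non-adjacent) wall-connected sub-families — the components of `Y₀ = ∪Y_i ⊆ Z₀` — [II] (2.32) p.18
«Σ_i d_k(Y_i) + 4M⁻⁴|Z₀∖Y₀| ≥ d_k(Z₀)».  In print `Y_i` are unions of localization domains (⊇ a block `□̃`) and `Z₀∖Y₀`
the `M`-cubes of a polymer `P`; this Prop quantifies over ALL cube families of the stated shape. [cite: Balaban1988RG2Cluster, (2.32) p.18] -/
def PrintedIneq232 (ν : ℕ) (G : Type*) [AddCommGroup G] [One G] [DecidableEq G] : Prop :=
  ∀ (Z₀ : Finset (Fin ν → G)) (a : Fin ν → G), Polymer.IsConn WallAdj Z₀ a →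
    ∀ Ys : Finset (Finset (Fin ν → G)), (∀ Y ∈ Ys, Y ⊆ Z₀) → (∀ Y ∈ Ys, ∃ b ∈ Y, Polymer.IsConn WallAdj Y b) →
      (∀ Y ∈ Ys, ∀ Y' ∈ Ys, Y ≠ Y' → ∀ y ∈ Y, ∀ y' ∈ Y', y ≠ y' ∧ ¬ WallAdj y y') →
      linSize Z₀ ≤ ∑ Y ∈ Ys, linSize Y + 4 * (Z₀ \ Ys.biUnion id).card

/-- **THE PRINTED (2.32) FAILS FOR GENERAL CUBE FAMILIES IN `ℤ⁴` (kernel counterexample)**: the plus `Z₀` (nine cubes),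
`Y₀ = Z₀ ∖ {0}` with its four two-cube components `Y_i` (`d(Y_i) = 0`, `M⁻⁴|Z₀∖Y₀| = 1`): the printed right side is `4`,
but `d(Z₀) ≥ 6` (`six_le_linSize_plusZ`).  The failure is the HUB: reconnecting `n` components through one cube costs up
to `ν + 1` edges EACH, not `4` per removed cube; the repaired inequality `linSize_add_le_sum_add_mul_card_sdiff` charges
`ν + 1` per component and per removed cube.  (Print's `Y_i` are fat — unions of localization domains — a regime this
example does not address.) [cite: Balaban1988RG2Cluster, (2.32) p.18] -/
theorem not_printedIneq232 : ¬ PrintedIneq232 4 ℤ := by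
  classical
  intro h
  have hsub : ∀ Y ∈ armsZ, Y ⊆ plusZ := by
    intro Y hY
    simp only [armsZ, Finset.mem_insert, Finset.mem_singleton] at hY
    rcases hY with rfl | rfl | rfl | rfl <;> simp [plusZ, Finset.insert_subset_iff]
  have hconn : ∀ Y ∈ armsZ, ∃ b ∈ Y, Polymer.IsConn WallAdj Y b := by
    intro Y hY
    simp only [armsZ, Finset.mem_insert, Finset.mem_singleton] at hY
    rcases hY with rfl | rfl | rfl | rfl
    · exact ⟨ue 0, by simp, isConn_pair ⟨0, Or.inl rfl⟩⟩
    · exact ⟨-ue 0, by simp, isConn_pair ⟨0, Or.inr rfl⟩⟩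
    · exact ⟨ue 1, by simp, isConn_pair ⟨1, Or.inl rfl⟩⟩
    · exact ⟨-ue 1, by simp, isConn_pair ⟨1, Or.inr rfl⟩⟩
  have hsep : ∀ Y ∈ armsZ, ∀ Y' ∈ armsZ, Y ≠ Y' → ∀ y ∈ Y, ∀ y' ∈ Y', y ≠ y' ∧ ¬ WallAdj y y' := by
    intro Y hY Y' hY' hne y hy y' hy'
    simp only [armsZ, Finset.mem_insert, Finset.mem_singleton] at hY hY'
    rcases hY with rfl | rfl | rfl | rfl <;> rcases hY' with rfl | rfl | rfl | rfl <;>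
      first
      | exact absurd rfl hne
      | (simp only [Finset.mem_insert, Finset.mem_singleton] at hy hy'
         rcases hy with rfl | rfl <;> rcases hy' with rfl | rfl <;>
           exact ne_and_not_wallAdj_of_two_le (by simp [ue]))
  have hsum : ∑ Y ∈ armsZ, linSize Y = 0 := by
    refine Finset.sum_eq_zero fun Y hY => ?_
    simp only [armsZ, Finset.mem_insert, Finset.mem_singleton] at hY
    rcases hY with rfl | rfl | rfl | rfl
    · refine linSize_eq_zero_of_common_corner (c := ue 0 + ue 0) fun m hm => ?_
      simp only [Finset.mem_insert, Finset.mem_singleton] at hm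
      rcases hm with rfl | rfl
      · exact ⟨{0}, by rw [cornerVec_singleton]; rfl⟩
      · exact isCorner_self _
    · refine linSize_eq_zero_of_common_corner (c := -ue 0) fun m hm => ?_
      simp only [Finset.mem_insert, Finset.mem_singleton] at hm
      rcases hm with rfl | rfl
      · exact isCorner_self _
      · exact ⟨{0}, by rw [cornerVec_singleton]; simp [ue]⟩
    · refine linSize_eq_zero_of_common_corner (c := ue 1 + ue 1) fun m hm => ?_
      simp only [Finset.mem_insert, Finset.mem_singleton] at hm
      rcases hm with rfl | rfl
      · exact ⟨{1}, by rw [cornerVec_singleton]; rfl⟩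
      · exact isCorner_self _
    · refine linSize_eq_zero_of_common_corner (c := -ue 1) fun m hm => ?_
      simp only [Finset.mem_insert, Finset.mem_singleton] at hm
      rcases hm with rfl | rfl
      · exact isCorner_self _
      · exact ⟨{1}, by rw [cornerVec_singleton]; simp [ue]⟩
  have hcard : (plusZ \ armsZ.biUnion id).card ≤ 1 := by
    have hsub' : plusZ \ armsZ.biUnion id ⊆ {0} := by
      intro z hz
      rw [Finset.mem_sdiff] at hz
      obtain ⟨hz, hzU⟩ := hz
      simp only [armsZ, Finset.mem_biUnion, id, Finset.mem_insert, Finset.mem_singleton, not_exists, not_and] at hzU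
      simp only [plusZ, Finset.mem_insert, Finset.mem_singleton] at hz
      rcases hz with rfl | rfl | rfl | rfl | rfl | rfl | rfl | rfl | rfl
      · exact Finset.mem_singleton_self _
      · exact absurd (hzU _ (Or.inl rfl)) (by simp)
      · exact absurd (hzU _ (Or.inl rfl)) (by simp)
      · exact absurd (hzU _ (Or.inr (Or.inl rfl))) (by simp)
      · exact absurd (hzU _ (Or.inr (Or.inl rfl))) (by simp)
      · exact absurd (hzU _ (Or.inr (Or.inr (Or.inl rfl)))) (by simp)
      · exact absurd (hzU _ (Or.inr (Or.inr (Or.inl rfl)))) (by simp)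
      · exact absurd (hzU _ (Or.inr (Or.inr (Or.inr rfl)))) (by simp)
      · exact absurd (hzU _ (Or.inr (Or.inr (Or.inr rfl)))) (by simp)
    exact (Finset.card_le_card hsub').trans (by simp)
  have hmain := h plusZ 0 isConn_plusZ armsZ hsub hconn hsep
  have h6 := six_le_linSize_plusZ
  rw [hsum] at hmain
  omega

end Counterexample

/-! ## §7 End-to-end: NE9 ∧ fading memory on a torus cube chart from decay of the coefficient tables in the LINEAR SIZE -/

section LinSizeDecay

variable {ν : ℕ} {G : Type*} [AddCommGroup G] [One G] [DecidableEq G]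

/-- **DECAY IN `d(Y)` GIVES PER-DOMAIN DECAY IN THE NUMBER OF CUBES (kernel)**: coefficient tables bounded by
`α₄(k)·e^{−a·d(dom Y)}` — TYPE: the summand «+ Σ_{Y∈𝐃} α₄exp(−δκd_k(Y))» of [II] (2.20) p.16 (= contour radius (2.18) p.16
«1/|τ(Y)| = E₀ε₁C₁α₄⁻¹M^q exp C₂κ₁ exp(−(1 − 3δ)κd_k(Y))» × table size (1.36)), `a = δκ`; the per-term shape is that of
[I] (0.25) p.257 «|𝐄^{(j)}(X, U)| ≤ E₀exp(−κd_j(X))» with the instantiator's renaming `E₀ ↦ α₄(k)`, `d_j ↦` the lattice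
`d` (`linSize`) — on domains that are wall-connected when nonempty ([I] p.257), are bounded by
`(α₄(k)e^{a})·(e^{−a/2^ν})^{#dom Y}` — the hypothesis `hcdec` of
`T4HistoryLipschitzSegment.cubeChart_ne9_and_fadingMemory_of_domainDecay` — by the corrected lower half of (2.30)
(`exp_neg_mul_linSize_le`). [cite: Balaban1988RG2Cluster, (2.18)-(2.20) p.16, (2.30) p.18; Balaban1987RG1, (0.25) p.257] -/
theorem domainDecay_of_linSizeDecay {F Bg Ω P : Type*} {c : ℕ → ℝ → Bg → P → Ω → F → ℂ}
    {dom : ℕ → P → F → Finset (Fin ν → G)} {α4 : ℕ → ℝ} {a : ℝ} (hα4 : ∀ k, 0 ≤ α4 k) (ha : 0 ≤ a)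
    (hlin : ∀ k s U γ ω Y, ‖c k s U γ ω Y‖ ≤ α4 k * Real.exp (-(a * (linSize (dom k γ Y) : ℝ))))
    (hdomconn : ∀ k γ Y, (dom k γ Y).Nonempty → ∃ b ∈ dom k γ Y, Polymer.IsConn WallAdj (dom k γ Y) b) :
    ∀ k s U γ ω Y, ‖c k s U γ ω Y‖ ≤ α4 k * Real.exp a * Real.exp (-(a / 2 ^ ν)) ^ (dom k γ Y).card := by
  intro k s U γ ω Y
  refine (hlin k s U γ ω Y).trans ?_
  rw [mul_assoc]
  refine mul_le_mul_of_nonneg_left ?_ (hα4 k)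
  by_cases hne : (dom k γ Y).Nonempty
  · obtain ⟨b, -, hb⟩ := hdomconn k γ Y hne
    exact exp_neg_mul_linSize_le ha ⟨_, isSkeleton_self_of_isConn hb⟩
  · rw [Finset.not_nonempty_iff_eq_empty.1 hne, Finset.card_empty, pow_zero, mul_one]
    calc Real.exp (-(a * (linSize (∅ : Finset (Fin ν → G)) : ℝ))) ≤ Real.exp 0 :=
          Real.exp_le_exp.2 (neg_nonpos.2 (mul_nonneg ha (Nat.cast_nonneg _)))
      _ ≤ Real.exp a := Real.exp_le_exp.2 ha

end LinSizeDecay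

section EndToEndLinSize

open BoundedContinuousFunction

variable {ν N : ℕ} {C : Carriers} {D : ℕ}
variable {Bg : Type} {Sp : Type*} [TopologicalSpace Sp] [MeasurableSpace Sp] [OpensMeasurableSpace Sp] {F : Type*}
  [Fintype F] {Ω : Type*} [MeasurableSpace Ω]

/-- **NE9 ∧ FADING MEMORY ON A TORUS CUBE CHART FROM DECAY IN THE LINEAR SIZE (kernel end-to-end).**
`T4HistoryLipschitzSegment.cubeChart_ne9_and_fadingMemory_of_domainDecay` on a chart over the discrete torus `Fin ν → ZMod N`
with the wall adjacency `torusAdj ν N` (= `WallAdj`, `wallAdj_eq_torusAdj`), with its (L‴) per-domain decay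
`‖c_ω(Y)‖ ≤ αc k·y₁^{#dom Y}` REPLACED by the print-typed decay IN THE LINEAR SIZE `‖c_ω(Y)‖ ≤ α₄(k)·e^{−a·d(dom Y)}` (TYPE:
the (2.20) summand «+ Σ_{Y∈𝐃} α₄exp(−δκd_k(Y))» of [II] p.16 = radius (2.18) × size (1.36), `a = δκ`, shape of [I] (0.25)
p.257, with `d = d_k` of [I] p.257 in its lattice-edge form `linSize`), the smallness now reading
`e^{−a/2^ν}·e^{Dθ₁} ≤ θ₁`, `α₄(k)e^{a}θ₁ ≤ lip k` (corrected lower half of (2.30), `domainDecay_of_linSizeDecay`).  All other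
data and the conclusion are those of the v1.4 theorem (finite torus; no infinite-volume or continuum claim).
[cite: Balaban1988RG2Cluster, (2.18)-(2.20) p.16, (2.30) p.18, (1.26) p.8; Balaban1987RG1, p.257, (0.26) p.257; FriedliVelenik2017, Lemma 3.38] -/
theorem torus_ne9_and_fadingMemory_of_linSizeDecay (Γ : CubeChart C (Fin ν → ZMod N) (torusAdj ν N) D) {ι : Type}
    {E : Functional C Bg}
    {W : Set (ℕ → ℝ)} {Adm : Set (Bg → C.Dom → ℝ)} {T : ℕ → (ℕ → ℝ) → (Bg → C.Dom → ℝ) → ι → ℝ}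
    {Ψ : ℕ → ℝ → (ι → ℝ) → Bg → C.Dom → ℝ}
    {μ : ℕ → ℝ → Bg → Finset (Fin ν → ZMod N) → Measure Ω} {pre : ℕ → ℝ → Bg → Finset (Fin ν → ZMod N) → Ω → ℂ}
    {c : ℕ → ℝ → Bg → Finset (Fin ν → ZMod N) → Ω → F → ℂ}
    {pt : ℕ → ℝ → Bg → Finset (Fin ν → ZMod N) → Ω → F → Sp} {β : ℕ → Sp → ℝ}
    {dom : ℕ → Finset (Fin ν → ZMod N) → F → Finset (Fin ν → ZMod N)}
    {lip ε α4 : ℕ → ℝ} {y a₁ d₁ θ κ lipbar ℓ τbar ω a θ₁ : ℝ} {wt : ℕ → ι → ℝ} {τ : ℕ → ℕ → ℝ} {lam p₀ Nsz : ℕ → ℝ}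
    (ρ : ℕ → (ι → ℝ) → (Sp →ᵇ ℂ))
    (h0 : ScaleZeroFree E W) (hAdm : AdmissibleTerms E W Adm) (hres : AdmRestrict Adm)
    (hadd : ChannelAdditive Adm T) (hsum : ChannelStepSum Adm T) (hstep : ChannelSizeAtStepNN Adm T κ wt τ)
    (hfac : Factorises E W T Ψ) (hlast : LastCouplingLipschitz E W T Ψ κ lam)
    (hρ : ∀ (k : ℕ) (P P' : ι → ℝ) (M : ℝ), (∀ y, |P y - P' y| ≤ wt k y * M) → ‖ρ k P - ρ k P'‖ ≤ M)
    (hΨ : ∀ (k : ℕ) (s : ℝ) (P P' : ι → ℝ) (U : Bg) (X : C.Dom),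
      Ψ k s P U X - Ψ k s P' U X =
        (Γ.geom.newTerm (Γ.geom.avgExpLinearAct μ pre fun k s U γ ω => evalFunctional (c k s U γ ω) (pt k s U γ ω))
            k s U X (ρ k P) -
          Γ.geom.newTerm (Γ.geom.avgExpLinearAct μ pre fun k s U γ ω => evalFunctional (c k s U γ ω) (pt k s U γ ω))
            k s U X (ρ k P')).re)
    (hexpl : ∀ g ∈ W, ∀ (k : ℕ) (P : ι → ℝ) (U : Bg) (X : C.Dom), C.scale X = k + 1 →
      |Ψ k (g k) P U X -
          (Γ.geom.newTerm (Γ.geom.avgExpLinearAct μ pre fun k s U γ ω => evalFunctional (c k s U γ ω) (pt k s U γ ω))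
            k (g k) U X (ρ k P)).re| ≤ Real.exp (-(κ * C.d X)) * p₀ k)
    (hbase : ∀ g ∈ W, ∀ (U : Bg) (X : C.Dom), C.scale X = 0 → |E g U X| ≤ Real.exp (-(κ * C.d X)) * Nsz 0)
    (hNsucc : ∀ j, p₀ j + a₁ ≤ Nsz (j + 1)) (hNnn : ∀ j, 0 ≤ Nsz j)
    (hbox : ∀ (k : ℕ) (P : ι → ℝ), (∀ y, |P y| ≤ wt k y * sizeRadius τ Nsz k) → ∀ x, ‖ρ k P x‖ ≤ β k x)
    (hpre : ∀ k s U γ, AEStronglyMeasurable (pre k s U γ) (μ k s U γ))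
    (hc : ∀ k s U γ Y, AEStronglyMeasurable (fun ω => c k s U γ ω Y) (μ k s U γ))
    (hpt : ∀ k s U γ Y, Measurable fun ω => pt k s U γ ω Y) (hlip : ∀ k, 0 < lip k) (hlipb : ∀ k, lip k ≤ lipbar)
    (hint₀ : ∀ k s U γ, Integrable (fun ω => ‖pre k s U γ ω‖ * Real.exp (boxExponent c pt β k s U γ ω)) (μ k s U γ))
    (hmeet : ∀ k s U (γ : Finset (Fin ν → ZMod N)) ω Y, c k s U γ ω Y ≠ 0 → ∃ x ∈ γ, x ∈ dom k γ Y)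
    -- DECAY IN THE LINEAR SIZE of the coefficient tables + wall-connected, injectively labelled domains + smallness
    (hα4 : ∀ k, 0 ≤ α4 k) (ha : 0 ≤ a) (hθ₁ : Real.exp (-(a / 2 ^ ν)) * Real.exp (D * θ₁) ≤ θ₁)
    (hliplb : ∀ k, α4 k * Real.exp a * θ₁ ≤ lip k)
    (hlin : ∀ k s U (γ : Finset (Fin ν → ZMod N)) ω Y,
      ‖c k s U γ ω Y‖ ≤ α4 k * Real.exp (-(a * (linSize (dom k γ Y) : ℝ))))
    (hdomconn : ∀ k (γ : Finset (Fin ν → ZMod N)) Y, (dom k γ Y).Nonempty →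
      ∃ b ∈ dom k γ Y, Polymer.IsConn (torusAdj ν N) (dom k γ Y) b)
    (hdominj : ∀ k (γ : Finset (Fin ν → ZMod N)), Set.InjOn (dom k γ) {Y | (dom k γ Y).Nonempty})
    (hε : ∀ k, 0 ≤ ε k) (hy : 0 ≤ y)
    (hdecay₀ : ∀ g ∈ W, ∀ (k : ℕ) (U : Bg) (X : C.Dom), C.scale X = k + 1 → ∀ γ' ∈ Γ.vol X,
      ∫ ω, ‖pre k (g k) U γ' ω‖ * Real.exp (boxExponent c pt β k (g k) U γ' ω) ∂(μ k (g k) U γ') ≤ ε k * y ^ γ'.card)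
    (hθ : 2 * y * Real.exp (a₁ + d₁) * Real.exp (D * θ) ≤ θ) (hεθ : ∀ k, 2 * ε k * θ * ((D : ℝ) + 1) ≤ a₁)
    (ha₁ : 0 ≤ a₁) (hκ : 0 ≤ κ) (hκd : κ ≤ d₁) (hℓ : 0 ≤ ℓ) (hτbar : 0 ≤ τbar) (hω : 0 ≤ ω)
    (hpos : 0 < ω + 4 * lipbar * a₁ * τbar) (hlam : ∀ k, lam k ≤ ℓ)
    (hτ : ∀ k j, j ≤ k → 0 ≤ τ k j ∧ τ k j ≤ τbar * ω ^ (k - j)) :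
    NE9 E W κ (prodModuli ℓ fun _ => ω + 4 * lipbar * a₁ * τbar) ∧
      FadingMemory (ℓ / (ω + 4 * lipbar * a₁ * τbar)) (ω + 4 * lipbar * a₁ * τbar)
        (prodModuli ℓ fun _ => ω + 4 * lipbar * a₁ * τbar) :=
  cubeChart_ne9_and_fadingMemory_of_domainDecay Γ ρ h0 hAdm hres hadd hsum hstep hfac hlast hρ hΨ hexpl hbase hNsucc hNnn
    hbox hpre hc hpt hlip hlipb hint₀ hmeet (fun k => mul_nonneg (hα4 k) (Real.exp_pos a).le) (Real.exp_pos _).le hθ₁ hliplb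
    (domainDecay_of_linSizeDecay (G := ZMod N) hα4 ha hlin hdomconn) hdomconn hdominj hε hy hdecay₀ hθ hεθ ha₁ hκ hκd hℓ
    hτbar hω hpos hlam hτ

end EndToEndLinSize

end Literature.MathematicalPhysics.QuantumFieldTheory.Balaban1983to89.T4HistoryLipschitzLinearSize

end
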